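/-
Copyright: statement-level skeleton of a published paper (lit-balaban cell, Phase-2 proof seat p39 gen 19). No proof claims
beyond what the kernel checks below.
-/
import Literature.MathematicalPhysics.QuantumFieldTheory.Balaban1983to89.B3Eq337ZeroLattice
import Literature.MathematicalPhysics.QuantumFieldTheory.Balaban1983to89.B3Eq338KernelForm

/-!
# B3 — T. Bałaban, *(Higgs)₂,₃ quantum fields in a finite volume. III. Renormalization*, CMP **88** (1983) 411–445
[Balaban1983Higgs3], p. 444 [PDF 34], the replacement sentence for the factor of the graph **(2.21c)**, ON THE PRINTED INFINITE
LATTICE ξℤ³: *"Now we replace the propagators G^η_{j₀}(0), G^η_{j₀} by C^ξ in the way described several times. We get a convergent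
expression plus Σ_{y,y″}ξ^{2d}Γ″_μ(y,y′,y″) defined with the help of the propagator C^ξ. … For the graph (2.21c) it equals 0 also
because by translation invariance it can be written as a derivative of a constant."*

statement-level skeleton of published theorems with citation tags; proofs where landed; nothing here is a claim about
the Yang–Mills mass gap

PDF held: `paper:balaban1983-higgs-2-3-quantum-fields-finite-volume` (journal page = PDF page + 410); p. 444 [PDF 34] read on the
×2 render `run/shared/lean/pub/pub-balaban/b2b-balaban-ref1/pages/1983-cmp88-higgs23-III/1983-cmp88-higgs23-III-p034-x2.png` (the
sentences above verbatim; the picture (2.21c) p. 430 [PDF 20] on `…-p020-x2.png`: the external vector leg and one scalar leg at the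
vertex `x′`, a scalar line to an internal vertex `z`, and a LOOP made of a scalar line and a vector line between `z` and the vertex
of the second external scalar leg `x″`).  Row **B3.Eq3.33-3.38** of `HOME/lit-balaban-r15/ROWS-B3.md` (fold owner r15; head
`proved` since ROWS v1.263 on the lead's Q13 word — this file is a located member).  CONTEXT.  The factor
`Σ_{x,x″}η^{2d}Γ′_μ(x,x′,x″)` of (3.36) for the graph (2.21c) is typed on ηℤ^{d+1} in `B3GammaPrimeVanishing`
(`locFactorZ_gamma221cZ`: `Σ_{x″}η^dΣ_zη^dΣ_ν(∂^η_μG₁∂^{η*}_ν)(x′,z)(G₂∂^{η*}_ν)(z,x″)G₃(z,x″)`), where its VANISHING is proved for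
TRANSLATION-INVARIANT propagators (`locFactorZ_gamma221cZ_eq_zero`, instance `C^ξ`).  The infinite-lattice propagator `G_k(0)` of
print's §3 is NOT translation invariant (only block-translation invariant), and print asserts the vanishing only AFTER the passage
to `C^ξ`: this file proves the passage — the replacement sentence — for the (2.21c) factor at the zero-field instance on ξℤ³, as
gens 10 of this seat did for the graphs (2.19) (`B3Eq337ZeroLattice`) and (2.20) (`B3Eq338ZeroLattice`): with the three propagator
slots filled by infinite-lattice propagators `G_i = G^ξ_k(0)` (p03's `GkLat` rescaled, `B3Eq316ResolventZeroLattice.GxiL`, with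
INDEPENDENT window parameters `(a_i, m_i²)` — the vector line `G_{j₀}` of the loop is read, as in the row's other members, as the
same lattice operator with its own parameters) and `G_i = C^ξ + M_i` (`M = G(1 − m² − aP)C^ξ`, the resolvent identity of p. 437),
the factor equals the pure-`C^ξ` factor — which is `0` *"by translation invariance … a derivative of a constant"* (the loop
`Σ_{x″}(C^ξ∂^{ξ*}_ν)(z−x″)C^ξ(z−x″)` does not depend on the vertex `z`) — plus terms containing at least one difference kernel `M`,
EACH BOUNDED UNIFORMLY in the spacing `ξ = L^{−k}` and the position (*"a convergent expression"*), although the (2.21c) factor is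
of degree `0` (each product of propagator laws alone is only logarithmically bounded).  No translation invariance of `G_k(0)` is
used anywhere: the `z`-dependence of the loop is controlled by its lattice derivative.
WHAT IS PROVED (`d = 3`, `ξ = xiOf ℓ k = L^{−k}`, volume element `Σ ξ³`, kernels and differences `dK1`/`dK2`/`d2K`, profiles
`P_q^δ = prof ξ δ q` of `B3Eq316DifferenceKernelBounds`):
* §1 MODEL-FREE: **`loop221c`** `B_ν[K₂,K₃](z) = Σ'_{x″}ξ³(K₂∂^{ξ*}_ν)(z,x″)K₃(z,x″)` (the loop of (2.21c)); **`fac221c`**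
  `F[K₁,K₂,K₃](x′) = Σ'_zξ³Σ_ν(∂^ξ_μK₁∂^{ξ*}_ν)(x′,z)·B_ν[K₂,K₃](z)` (the (2.21c) factor with kernel slots; the internal vertex `z`
  summed last); `loop221c_convK` — on convolution kernels the loop is the constant `Σ'_uξ³(∂^{ξ*}_νC₂)(u)C₃(u)`;
  `d2K_convK_eq_fwdDiff` — `(∂_μC∂^*_ν)(x′−z) = ξ^{−1}[(∂_μC)(x′−z−e_ν) − (∂_μC)(x′−z)]`, a lattice difference in `z`;
  **`fac221c_convK_eq_zero`** — *"a derivative of a constant"*: `F[C₁,C₂,C₃] = 0` for convolution kernels with `C₁` summable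
  (no hypothesis on the loop); **`fac221c_convK_eq_sbp`** — SUMMATION BY PARTS in `z` for a translation-invariant first slot and
  ARBITRARY `K₂, K₃`: `F[C,K₂,K₃](x′) = Σ_ν ξ²Σ'_z(∂_μC)(x′−z)[B_ν(z−e_ν) − B_ν(z)]`.
* §2 AT THE INSTANCE (`G_i = GxiL ℓ k a_i m_i`, `M_i = MxiL …`, `C^ξ = Cxi 3 ξ`; laws and Fubini clauses of gen 9's
  `B3Eq316DifferenceKernelBounds.exists_bounds`, one rate `δ`; the lemmas are stated for arbitrary kernels with these laws):
  `loop_summand_split`/`loop221c_eq_split` (`B[G₂,G₃] = B[C,C] + B[C,M₃] + B[M₂,G₃]`); the loop constant `|B[C^ξ,C^ξ]| ≤ ½C²·53` (square completion `Σ(a−b)b = −½Σ(a−b)²` and `Σ_{u∈ℤ³}max(1,|u|)^{−4}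
  ≤ 53` — this constant is the vertex (3.24)); `|B[C,M₃](z)| ≤ CK·833/δ³`; `|B[M₂,G₃](z)| ≤ Λ₂` (Fubini at rate `δ/2`); the
  LATTICE DERIVATIVE OF THE LOOP: `ξ^{−1}|B[G₂,G₃](w+e_ρ) − B[G₂,G₃](w)| ≤ Λ₁` uniformly — `B[C,C]` drops out exactly, `B[M₂,G₃]`
  by the plain difference (mixed difference `∂M₂∂^*` against `G₃`, `M₂∂^*` against `∂G₃` by Fubini), `B[C,M₃]` after moving the
  difference onto `M₃` by summation by parts in `x″` (`loop_convK_M_eq_sbp`), then `∂C` against `M₃∂^*` by Fubini (centre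
  shifted by one lattice unit) and `C` against `∂M₃∂^*`.
* §3 **`exists_fac221c_bound`** — for `L = ℓ+1 ≥ 2` and a window `[a₋,a₊] × [0,m²₊]`, `a₋ > 0`, there is `Cst` such that for
  every `k ≥ 1`, all three parameter pairs in the window, all `μ`, `x′`: the loop series and the `z`-series converge absolutely,
  **`|F[G₁,G₂,G₃](x′) − F[C^ξ,C^ξ,C^ξ](x′)| ≤ Cst`** (the convergent expression), `F[C^ξ,C^ξ,C^ξ](x′) = 0` (the derivative of a
  constant), hence **`|F[G₁,G₂,G₃](x′)| ≤ Cst`** — the coefficient of the local vertex (3.36) for the graph (2.21c) is bounded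
  uniformly in the spacing and the position.
HONEST SCOPE: zero external field, `d = 3`, the printed infinite lattice; scalar structure part of Γ′ only (charge matrices and
coupling constants factor out, as in `B3GammaPrimeVanishing`); the three slots are zero-field scalar-type lattice propagators
`(−Δ^ξ + m² + aP)^{−1}` (a MODEL INSTANCE for the vector line, as in the row's other members); constants existential, uniform in
`k ≥ 1` and the window; the permuted graph of (2.21c) (whose factor vanishes for arbitrary kernels,
`B3GammaPrimeVanishing`) and the other classes are not treated here; no bridge lemma to `B3GammaPrimeVanishing.locFactorZ` is stated
(that file sums the external vertex `x″` last; the two orders agree by absolute convergence — not needed here).  Mathlib + the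
cited tree files only; two model-free `def`s with bodies (`loop221c`, `fac221c`), theorems; no named facts; standard axioms.
Unit `lit-balaban-p39` (Phase-2 proof seat p39, gen 19), HOME `run/shared/lean/pub/lit-balaban/`, 2026-08-23.
-/

open scoped BigOperators
open Finset Filter Topology

namespace Literature.MathematicalPhysics.QuantumFieldTheory.Balaban1983to89.B3Graph221cZeroLattice

open B3Sect3VectorSelfEnergy B3CxiUniformBound B3ZdLatticeProfileSums B3ZdKernelConvolutions B3Eq316ResolventZeroLattice
  B3Eq316DifferenceKernelBounds
open B3Eq337ZeroLattice (convK dK1_conv dK2_convK GxiL_eq_conv_add summable_prof_sub)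
open B3Eq338KernelForm (tsum_fwdDiff_mul summable_shift_mul)
open B3CxiPropagator (summable_Cxi)
open B3CxiLatticePairSums (supNorm_unitVec)

noncomputable section

/-! ## §1 The (2.21c) factor with kernel slots (model-free) -/

section ModelFree

variable {ξ : ℝ}

/-- **the loop of the graph (2.21c)**: the scalar line `(K₂∂^{ξ*}_ν)(z,x″)` (differentiated at the vertex of the external leg
`x″`, bond direction `ν`) and the vector line `K₃(z,x″)` between the internal vertex `z` and the vertex `x″`, summed over `x″`:
`B_ν[K₂,K₃](z) = Σ'_{x″} ξ³ (K₂∂^{ξ*}_ν)(z,x″)·K₃(z,x″)`. [cite: Balaban1983Higgs3, (2.21) p.430; p.444] -/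
def loop221c (ξ : ℝ) (ν : Fin 3) (K₂ K₃ : ZSite 3 → ZSite 3 → ℝ) (z : ZSite 3) : ℝ :=
  ∑' x'' : ZSite 3, ξ ^ 3 * (dK2 ξ ν K₂ z x'' * K₃ z x'')

/-- **the factor `Σ_{x,x″}ξ^{2d}Γ′_μ(x,x′,x″)` of (3.36) for the graph (2.21c)** with its three propagator slots as two-variable
kernels on ξℤ³ (scalar structure part; the formula of `B3GammaPrimeVanishing.locFactorZ_gamma221cZ` on the scale `ξ`, the internal
vertex summed last): `F[K₁,K₂,K₃](x′) = Σ'_z ξ³ Σ_ν (∂^ξ_μK₁∂^{ξ*}_ν)(x′,z)·B_ν[K₂,K₃](z)`. [cite: Balaban1983Higgs3, (3.36) p.444] -/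
def fac221c (ξ : ℝ) (μ : Fin 3) (K₁ K₂ K₃ : ZSite 3 → ZSite 3 → ℝ) (x' : ZSite 3) : ℝ :=
  ∑' z : ZSite 3, ξ ^ 3 * ∑ ν : Fin 3, d2K ξ μ ν K₁ x' z * loop221c ξ ν K₂ K₃ z

/-- **On convolution kernels the loop does not depend on the vertex** (translation invariance): `B_ν[C₂,C₃](z) =
Σ'_u ξ³ (∂^{ξ*}_νC₂)(u)·C₃(u)` for every `z` (re-indexing `u = z − x″`). [cite: Balaban1983Higgs3, p.444] -/
theorem loop221c_convK (ξ : ℝ) (ν : Fin 3) (C₂ C₃ : ZSite 3 → ℝ) (z : ZSite 3) :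
    loop221c ξ ν (convK C₂) (convK C₃) z = ∑' u : ZSite 3, ξ ^ 3 * (pdiffAdjZ ξ⁻¹ ν C₂ u * C₃ u) := by
  unfold loop221c
  have e := (Equiv.subLeft z).tsum_eq (fun u : ZSite 3 => ξ ^ 3 * (pdiffAdjZ ξ⁻¹ ν C₂ u * C₃ u))
  simp only [Equiv.subLeft_apply] at e
  rw [← e]
  refine tsum_congr fun x'' => ?_
  rw [dK2_convK]; rfl

/-- kernel: the mixed difference of a convolution kernel is a lattice difference IN THE SECOND VARIABLE of the once-differentiated
kernel: `(∂^ξ_μC∂^{ξ*}_ν)(x′, z) = ξ^{−1}[(∂^ξ_μC)(x′ − (z + e_ν)) − (∂^ξ_μC)(x′ − z)]`. [cite: Balaban1983Higgs3, p.444] -/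
theorem d2K_convK_eq_fwdDiff (ξ : ℝ) (μ ν : Fin 3) (C : ZSite 3 → ℝ) (x' z : ZSite 3) :
    d2K ξ μ ν (convK C) x' z = ξ⁻¹ * (dK1 ξ μ (convK C) x' (z + unitVec ν) - dK1 ξ μ (convK C) x' z) := by
  unfold d2K dK1 convK
  rw [show x' + unitVec μ - (z + unitVec ν) = x' - z - unitVec ν + unitVec μ by abel,
    show x' + unitVec μ - z = x' - z + unitVec μ by abel, show x' - (z + unitVec ν) = x' - z - unitVec ν by abel]
  ring

/-- kernel: for a summable `C`, the `z`-sum of the mixed difference `(∂^ξ_μC∂^{ξ*}_ν)(x′ − z)` vanishes — the difference of two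
translates of one convergent series. [cite: Balaban1983Higgs3, p.444] -/
theorem tsum_d2K_convK_eq_zero (ξ : ℝ) (μ ν : Fin 3) {C : ZSite 3 → ℝ} (hC : Summable C) (x' : ZSite 3) :
    Summable (fun z : ZSite 3 => d2K ξ μ ν (convK C) x' z) ∧ ∑' z : ZSite 3, d2K ξ μ ν (convK C) x' z = 0 := by
  -- `g(z) = (∂_μC)(x′ − z)` is summable
  set g : ZSite 3 → ℝ := fun z => dK1 ξ μ (convK C) x' z with hg
  have hCz : ∀ s : ZSite 3, Summable fun z : ZSite 3 => C (x' + s - z) := fun s =>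
    (Equiv.subLeft (x' + s)).summable_iff.2 hC
  have hgs : Summable g := by
    have h1 := hCz (unitVec μ)
    have h0 := hCz 0
    simp only [add_zero] at h0
    refine ((h1.sub h0).mul_left ξ⁻¹).congr fun z => ?_
    simp only [hg, dK1, convK]
  have hgs' : Summable fun z => g (z + unitVec ν) := (Equiv.addRight (unitVec ν)).summable_iff.2 hgs
  have hpt : ∀ z, d2K ξ μ ν (convK C) x' z = ξ⁻¹ * (g (z + unitVec ν) - g z) := fun z =>
    d2K_convK_eq_fwdDiff ξ μ ν C x' z
  refine ⟨((hgs'.sub hgs).mul_left ξ⁻¹).congr fun z => (hpt z).symm, ?_⟩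
  rw [tsum_congr hpt, tsum_mul_left, (hgs'.tsum_sub hgs)]
  have e := (Equiv.addRight (unitVec ν)).tsum_eq g
  simp only [Equiv.coe_addRight] at e
  rw [e, sub_self, mul_zero]

/-- **p. 444, (2.21c): *"by translation invariance it can be written as a derivative of a constant"*** — PROVED for convolution
kernels: if the differentiated line is a summable translation-invariant kernel `C₁(x′ − z)` and the loop lines are translation
invariant, `F[C₁,C₂,C₃](x′) = 0` for every `x′`, `μ` (the loop is a constant `S_ν`, and `Σ_z(∂_μC₁∂^*_ν)(x′−z)·S_ν` is `S_ν` times a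
vanishing sum of differences).  No convergence hypothesis on the loop is needed. [cite: Balaban1983Higgs3, p.444] -/
theorem fac221c_convK_eq_zero (ξ : ℝ) (μ : Fin 3) {C₁ : ZSite 3 → ℝ} (hC₁ : Summable C₁) (C₂ C₃ : ZSite 3 → ℝ)
    (x' : ZSite 3) : fac221c ξ μ (convK C₁) (convK C₂) (convK C₃) x' = 0 := by
  unfold fac221c
  -- the loop is the constant `S ν`
  set S : Fin 3 → ℝ := fun ν => ∑' u : ZSite 3, ξ ^ 3 * (pdiffAdjZ ξ⁻¹ ν C₂ u * C₃ u) with hS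
  have hloop : ∀ (ν : Fin 3) (z : ZSite 3), loop221c ξ ν (convK C₂) (convK C₃) z = S ν := fun ν z =>
    loop221c_convK ξ ν C₂ C₃ z
  simp_rw [hloop]
  have hs : ∀ ν ∈ (univ : Finset (Fin 3)), Summable fun z : ZSite 3 => ξ ^ 3 * (d2K ξ μ ν (convK C₁) x' z * S ν) :=
    fun ν _ => ((tsum_d2K_convK_eq_zero ξ μ ν hC₁ x').1.mul_right (S ν)).mul_left (ξ ^ 3)
  simp_rw [mul_sum]
  rw [Summable.tsum_finsetSum hs]
  refine sum_eq_zero fun ν _ => ?_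
  rw [tsum_mul_left, tsum_mul_right, (tsum_d2K_convK_eq_zero ξ μ ν hC₁ x').2, zero_mul, mul_zero]

/-- **(2.21c) for `C^ξ`**: `F[C^ξ,C^ξ,C^ξ](x′) = 0` on ξℤ³, `ξ > 0` — the pure-`C^ξ` term produced by the replacement
(`B3GammaPrimeVanishing.locFactorZ_gamma221cZ_cxi_eq_zero` in the other summation order). [cite: Balaban1983Higgs3, p.444] -/
theorem fac221c_Cxi_eq_zero {ξ : ℝ} (hξ : 0 < ξ) (μ : Fin 3) (x' : ZSite 3) :
    fac221c ξ μ (convK (Cxi 3 ξ)) (convK (Cxi 3 ξ)) (convK (Cxi 3 ξ)) x' = 0 :=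
  fac221c_convK_eq_zero ξ μ (summable_Cxi hξ) _ _ x'

/-- **SUMMATION BY PARTS IN THE INTERNAL VERTEX** for a translation-invariant differentiated line and ARBITRARY loop lines:
`F[C,K₂,K₃](x′) = Σ_ν ξ² Σ'_z (∂^ξ_μC)(x′ − z)·[B_ν[K₂,K₃](z − e_ν) − B_ν[K₂,K₃](z)]` — the lattice difference `∂^{ξ*}_ν` is moved
from the line `C` onto the loop; when the two families `z ↦ (∂_μC)(x′−z−e_ν)B_ν(z)`, `z ↦ (∂_μC)(x′−z)B_ν(z)` are summable.  For a
`z`-independent loop the right side vanishes (the derivative of a constant); for the lattice propagators it is controlled by the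
lattice derivative of the loop (§2). [cite: Balaban1983Higgs3, p.444] -/
theorem fac221c_convK_eq_sbp (hξ : ξ ≠ 0) (μ : Fin 3) (C : ZSite 3 → ℝ) (K₂ K₃ : ZSite 3 → ZSite 3 → ℝ) (x' : ZSite 3)
    (h1 : ∀ ν, Summable fun z : ZSite 3 => dK1 ξ μ (convK C) x' (z + unitVec ν) * loop221c ξ ν K₂ K₃ z)
    (h2 : ∀ ν, Summable fun z : ZSite 3 => dK1 ξ μ (convK C) x' z * loop221c ξ ν K₂ K₃ z) :
    fac221c ξ μ (convK C) K₂ K₃ x' = ∑ ν : Fin 3, ξ ^ 2 *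
      ∑' z : ZSite 3, dK1 ξ μ (convK C) x' z * (loop221c ξ ν K₂ K₃ (z - unitVec ν) - loop221c ξ ν K₂ K₃ z) := by
  unfold fac221c
  have hpt : ∀ (ν : Fin 3) (z : ZSite 3), ξ ^ 3 * (d2K ξ μ ν (convK C) x' z * loop221c ξ ν K₂ K₃ z) =
      ξ ^ 2 * ((dK1 ξ μ (convK C) x' (z + unitVec ν) - dK1 ξ μ (convK C) x' z) * loop221c ξ ν K₂ K₃ z) := by
    intro ν z
    rw [d2K_convK_eq_fwdDiff]
    field_simp
  have hs : ∀ ν ∈ (univ : Finset (Fin 3)), Summable fun z : ZSite 3 =>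
      ξ ^ 3 * (d2K ξ μ ν (convK C) x' z * loop221c ξ ν K₂ K₃ z) := by
    intro ν _
    refine (((h1 ν).sub (h2 ν)).mul_left (ξ ^ 2)).congr fun z => ?_
    rw [hpt, sub_mul]
  simp_rw [mul_sum]
  rw [Summable.tsum_finsetSum hs]
  refine sum_congr rfl fun ν _ => ?_
  rw [tsum_congr (hpt ν), tsum_mul_left, tsum_fwdDiff_mul (unitVec ν) (h1 ν) (h2 ν)]

end ModelFree

/-! ## §2 A lattice constant: `Σ_{u∈ℤ³} max(1,|u|_∞)^{−4} ≤ 53` -/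

section LatticeConstant

/-- kernel: `Σ_{1≤n<b} n^{−2} ≤ 2 − 2/b` (`b ≥ 1`), by `n^{−2} ≤ 2/n − 2/(n+1)`. [folklore] -/
private theorem sum_Ico_inv_sq_le_two_sub {b : ℕ} (hb : 1 ≤ b) :
    ∑ n ∈ Finset.Ico 1 b, ((n : ℝ) ^ 2)⁻¹ ≤ 2 - 2 / (b : ℝ) := by
  induction b, hb using Nat.le_induction with
  | base => simp
  | succ b hb ih =>
    rw [Finset.sum_Ico_succ_top hb, Nat.cast_succ]
    have hb' : (1 : ℝ) ≤ b := by exact_mod_cast hb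
    have hstep : ((b : ℝ) ^ 2)⁻¹ ≤ 2 / (b : ℝ) - 2 / ((b : ℝ) + 1) := by
      rw [div_sub_div _ _ (by positivity) (by positivity), le_div_iff₀ (by positivity)]
      field_simp
      nlinarith
    linarith

/-- kernel: `Σ_{1≤n<b} n^{−2} ≤ 2`. [folklore] -/
private theorem sum_Ico_inv_sq_le_two (b : ℕ) : ∑ n ∈ Finset.Ico 1 b, ((n : ℝ) ^ 2)⁻¹ ≤ 2 := by
  rcases Nat.eq_zero_or_pos b with rfl | hb
  · simp
  · exact (sum_Ico_inv_sq_le_two_sub hb).trans (by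
      have : (0 : ℝ) ≤ 2 / (b : ℝ) := by positivity
      linarith)

/-- **`Σ_{u∈ℤ³} max(1,|u|_∞)^{−4} ≤ 53`** (shells of `ℤ³` have `≤ 26n²` points; `1 + 26·Σn^{−2} ≤ 53`): the lattice constant
behind the bound of the pure-`C^ξ` loop (the vertex (3.24)). [cite: Balaban1983Higgs3, (3.24) p.439] -/
theorem summable_inv_max_pow_four :
    Summable (fun u : ZSite 3 => ((max 1 (supNorm u : ℝ)) ^ 4)⁻¹) ∧
      ∑' u : ZSite 3, ((max 1 (supNorm u : ℝ)) ^ 4)⁻¹ ≤ 53 := by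
  set h : ℕ → ℝ := fun n => ((max 1 (n : ℝ)) ^ 4)⁻¹ with hh
  have hh0 : ∀ n, 0 ≤ h n := fun n => by positivity
  have hfin : ∀ F : Finset (ZSite 3), ∑ u ∈ F, h (supNorm u) ≤ 53 := by
    intro F
    refine (sum_radial_le h hh0 F).trans ?_
    have h0 : h 0 = 1 := by simp [hh]
    have hterm : ∀ n ∈ Finset.Ico 1 (F.sup supNorm + 1), 26 * (n : ℝ) ^ 2 * h n ≤ 26 * ((n : ℝ) ^ 2)⁻¹ := by
      intro n hn
      rw [Finset.mem_Ico] at hn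
      have hn1 : (1 : ℝ) ≤ n := by exact_mod_cast hn.1
      have hmax : max 1 (n : ℝ) = n := max_eq_right hn1
      simp only [hh, hmax]
      have hn0 : (0 : ℝ) < n := by linarith
      rw [show 26 * (n : ℝ) ^ 2 * ((n : ℝ) ^ 4)⁻¹ = 26 * ((n : ℝ) ^ 2)⁻¹ by field_simp]
    calc h 0 + ∑ n ∈ Finset.Ico 1 (F.sup supNorm + 1), 26 * (n : ℝ) ^ 2 * h n
        ≤ 1 + ∑ n ∈ Finset.Ico 1 (F.sup supNorm + 1), 26 * ((n : ℝ) ^ 2)⁻¹ := by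
          rw [h0]; exact add_le_add le_rfl (Finset.sum_le_sum hterm)
      _ = 1 + 26 * ∑ n ∈ Finset.Ico 1 (F.sup supNorm + 1), ((n : ℝ) ^ 2)⁻¹ := by rw [Finset.mul_sum]
      _ ≤ 1 + 26 * 2 := by gcongr; exact sum_Ico_inv_sq_le_two _
      _ = 53 := by norm_num
  have h0' : ∀ u : ZSite 3, 0 ≤ h (supNorm u) := fun u => hh0 _
  exact ⟨summable_of_sum_le h0' hfin, Real.tsum_le_of_sum_le h0' hfin⟩

end LatticeConstant

/-! ## §3 The loop and its lattice derivative, for kernels with propagator laws (model-free in the kernels) -/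

section Loop

variable {ξ δ C K : ℝ}

/-- **THE PURE-`C^ξ` LOOP IS BOUNDED UNIFORMLY** — `|Σ'_u ξ³(∂^{ξ*}_νC)(u)C(u)| ≤ ½C²·53` for an even... (no evenness needed:)
for any summable `C` on ξℤ³ with `|∂^{ξ*}C| ≤ C·P₂^δ` (`0 < ξ ≤ 1`): by the square completion `Σ(a−b)b = −½Σ(a−b)²`
(`a = C(·−e_ν)`, `b = C`, `Σa² = Σb²`) the loop is `−½ξ²Σ'_u(C(u−e_ν) − C(u))² = −½ξ⁴Σ'_u(∂^{ξ*}_νC)(u)²`, and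
`ξ⁴P₂(u)² ≤ max(1,|u|)^{−4}`.  (Each factor's law alone gives only `Σξ³P₂P₁ ~ log ξ^{−1}`; this constant is the vertex (3.24).)
[cite: Balaban1983Higgs3, (3.24) p.439; p.444] -/
theorem abs_loopCC_le (hξ : 0 < ξ) (hδ : 0 ≤ δ) (hC : 0 ≤ C) {Cf : ZSite 3 → ℝ} (hCs : Summable Cf)
    (hCb : ∃ B, ∀ u, |Cf u| ≤ B) (hCx2a : ∀ (μ : Fin 3) (u : ZSite 3), |pdiffAdjZ ξ⁻¹ μ Cf u| ≤ C * prof ξ δ 2 u)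
    (ν : Fin 3) :
    Summable (fun u : ZSite 3 => ξ ^ 3 * (pdiffAdjZ ξ⁻¹ ν Cf u * Cf u)) ∧
      |∑' u : ZSite 3, ξ ^ 3 * (pdiffAdjZ ξ⁻¹ ν Cf u * Cf u)| ≤ 1 / 2 * C ^ 2 * 53 := by
  obtain ⟨B, hB⟩ := hCb
  have hB0 : 0 ≤ B := (abs_nonneg _).trans (hB 0)
  set e := unitVec ν with he
  -- `a = C(·−e)`, `b = C`; summability of the three quadratic families
  have hsa : Summable fun u : ZSite 3 => Cf (u - e) := (Equiv.subRight e).summable_iff.2 hCs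
  have hbb : Summable fun u : ZSite 3 => Cf u * Cf u :=
    Summable.of_norm_bounded (g := fun u => B * |Cf u|) (hCs.abs.mul_left B) fun u => by
      rw [Real.norm_eq_abs, abs_mul]; exact mul_le_mul_of_nonneg_right (hB u) (abs_nonneg _)
  have hab : Summable fun u : ZSite 3 => Cf (u - e) * Cf u :=
    Summable.of_norm_bounded (g := fun u => B * |Cf u|) (hCs.abs.mul_left B) fun u => by
      rw [Real.norm_eq_abs, abs_mul]; exact mul_le_mul_of_nonneg_right (hB _) (abs_nonneg _)
  have haa : Summable fun u : ZSite 3 => Cf (u - e) * Cf (u - e) := (Equiv.subRight e).summable_iff.2 hbb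
  have hsq : Summable fun u : ZSite 3 => (Cf (u - e) - Cf u) ^ 2 := by
    refine ((haa.sub (hab.mul_left 2)).add hbb).congr fun u => ?_; ring
  -- `Σa² = Σb²`
  have haabb : ∑' u : ZSite 3, Cf (u - e) * Cf (u - e) = ∑' u : ZSite 3, Cf u * Cf u := by
    have h := (Equiv.subRight e).tsum_eq (fun u : ZSite 3 => Cf u * Cf u)
    simp only [Equiv.subRight_apply] at h
    exact h
  -- the square completion
  have hcomp : ∑' u : ZSite 3, (Cf (u - e) - Cf u) * Cf u = -(1 / 2) * ∑' u : ZSite 3, (Cf (u - e) - Cf u) ^ 2 := by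
    have hpt : ∀ u : ZSite 3, (Cf (u - e) - Cf u) * Cf u =
        -(1 / 2) * (Cf (u - e) - Cf u) ^ 2 + (1 / 2) * (Cf (u - e) * Cf (u - e) - Cf u * Cf u) := fun u => by ring
    rw [tsum_congr hpt, ((hsq.mul_left _)).tsum_add ((haa.sub hbb).mul_left _), tsum_mul_left, tsum_mul_left,
      haa.tsum_sub hbb, haabb, sub_self, mul_zero, add_zero]
  -- the summand in terms of `a − b`
  have hpt2 : ∀ u : ZSite 3, ξ ^ 3 * (pdiffAdjZ ξ⁻¹ ν Cf u * Cf u) = ξ ^ 2 * ((Cf (u - e) - Cf u) * Cf u) := by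
    intro u; simp only [pdiffAdjZ, he]; field_simp
  have hs : Summable (fun u : ZSite 3 => ξ ^ 3 * (pdiffAdjZ ξ⁻¹ ν Cf u * Cf u)) :=
    (((hab.sub hbb).mul_left (ξ ^ 2))).congr fun u => by rw [hpt2]; ring
  refine ⟨hs, ?_⟩
  rw [tsum_congr hpt2, tsum_mul_left, hcomp]
  -- `|ξ²·(−½)Σ(a−b)²| = ½ξ²Σ(a−b)² ≤ ½C²Σ max(1,|u|)^{−4}`
  obtain ⟨hs4, hle4⟩ := summable_inv_max_pow_four
  have hsq0 : 0 ≤ ∑' u : ZSite 3, (Cf (u - e) - Cf u) ^ 2 := tsum_nonneg fun u => sq_nonneg _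
  rw [abs_mul, abs_of_pos (by positivity : (0 : ℝ) < ξ ^ 2), abs_mul, abs_of_nonneg hsq0,
    show |(-(1 / 2) : ℝ)| = 1 / 2 by norm_num]
  -- pointwise: `ξ²(a−b)² = ξ⁴(∂^*C)² ≤ C²·max(1,|u|)^{−4}`
  have hpt3 : ∀ u : ZSite 3, ξ ^ 2 * (Cf (u - e) - Cf u) ^ 2 ≤ C ^ 2 * ((max 1 (supNorm u : ℝ)) ^ 4)⁻¹ := by
    intro u
    have hd : Cf (u - e) - Cf u = ξ * pdiffAdjZ ξ⁻¹ ν Cf u := by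
      simp only [pdiffAdjZ, he]; field_simp
    have hm1 : (1 : ℝ) ≤ max 1 (supNorm u : ℝ) := le_max_left _ _
    have hP : prof ξ δ 2 u ≤ ((ξ * max 1 (supNorm u : ℝ)) ^ 2)⁻¹ := by
      unfold prof
      refine mul_le_of_le_one_right (by positivity) ?_
      rw [Real.exp_le_one_iff]
      have : (0 : ℝ) ≤ δ * (ξ * (supNorm u : ℝ)) := by positivity
      linarith
    have h1 : |ξ * pdiffAdjZ ξ⁻¹ ν Cf u| ≤ ξ * (C * ((ξ * max 1 (supNorm u : ℝ)) ^ 2)⁻¹) := by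
      rw [abs_mul, abs_of_pos hξ]
      exact mul_le_mul_of_nonneg_left ((hCx2a ν u).trans (mul_le_mul_of_nonneg_left hP hC)) hξ.le
    have h2 : (Cf (u - e) - Cf u) ^ 2 ≤ (ξ * (C * ((ξ * max 1 (supNorm u : ℝ)) ^ 2)⁻¹)) ^ 2 := by
      rw [hd, ← sq_abs]
      exact pow_le_pow_left₀ (abs_nonneg _) h1 2
    calc ξ ^ 2 * (Cf (u - e) - Cf u) ^ 2 ≤ ξ ^ 2 * (ξ * (C * ((ξ * max 1 (supNorm u : ℝ)) ^ 2)⁻¹)) ^ 2 :=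
          mul_le_mul_of_nonneg_left h2 (by positivity)
      _ = C ^ 2 * ((max 1 (supNorm u : ℝ)) ^ 4)⁻¹ := by field_simp
  have hle : ξ ^ 2 * ∑' u : ZSite 3, (Cf (u - e) - Cf u) ^ 2 ≤ C ^ 2 * 53 := by
    rw [← tsum_mul_left]
    refine (((hsq.mul_left _)).tsum_le_tsum hpt3 (hs4.mul_left _)).trans ?_
    rw [tsum_mul_left]
    exact mul_le_mul_of_nonneg_left hle4 (by positivity)
  nlinarith

/-- **THE SPLIT OF THE LOOP SUMMAND** (pointwise): with `G_i = C + M_i` in both loop lines and linearity of the difference,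
`ξ³(G₂∂^*_ν)(z,x)G₃(z,x) = ξ³(∂^{ξ*}_νC)(z−x)C(z−x) + ξ³(∂^{ξ*}_νC)(z−x)M₃(z,x) + ξ³(M₂∂^*_ν)(z,x)G₃(z,x)` — the pure-`C` loop plus
the terms with at least one difference kernel. [cite: Balaban1983Higgs3, p.444] -/
theorem loop_summand_split (ξ : ℝ) (ν : Fin 3) {Cf : ZSite 3 → ℝ} {G₂ M₂ G₃ M₃ : ZSite 3 → ZSite 3 → ℝ}
    (hG2 : ∀ y x, G₂ y x = Cf (y - x) + M₂ y x) (hG3 : ∀ y x, G₃ y x = Cf (y - x) + M₃ y x) (z x : ZSite 3) :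
    ξ ^ 3 * (dK2 ξ ν G₂ z x * G₃ z x) =
      ξ ^ 3 * (pdiffAdjZ ξ⁻¹ ν Cf (z - x) * Cf (z - x)) + ξ ^ 3 * (pdiffAdjZ ξ⁻¹ ν Cf (z - x) * M₃ z x) +
        ξ ^ 3 * (dK2 ξ ν M₂ z x * G₃ z x) := by
  have h2 : dK2 ξ ν G₂ z x = pdiffAdjZ ξ⁻¹ ν Cf (z - x) + dK2 ξ ν M₂ z x := by
    simp only [dK2, pdiffAdjZ, hG2]
    rw [show z - (x + unitVec ν) = z - x - unitVec ν by abel]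
    ring
  rw [h2, hG3 z x]
  ring

/-- **the loop term `(∂^{ξ*}_νC)·M₃` is bounded uniformly**: `|Σ'_xξ³(∂^{ξ*}_νC)(z−x)M₃(z,x)| ≤ CK·833/δ³` (the `L¹` bound of a
once-differentiated profile and `|M₃| ≤ K`). [cite: Balaban1983Higgs3, p.444] -/
theorem abs_loopCM_le (hξ : 0 < ξ) (hξ1 : ξ ≤ 1) (hδ : 0 < δ) (hδ1 : δ ≤ 1) (hC : 0 ≤ C) (hK : 0 ≤ K)
    {Cf : ZSite 3 → ℝ} {M₃ : ZSite 3 → ZSite 3 → ℝ}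
    (hCx2a : ∀ (μ : Fin 3) (u : ZSite 3), |pdiffAdjZ ξ⁻¹ μ Cf u| ≤ C * prof ξ δ 2 u) (hM3 : ∀ y y', |M₃ y y'| ≤ K)
    (ν : Fin 3) (z : ZSite 3) :
    Summable (fun x : ZSite 3 => ξ ^ 3 * (pdiffAdjZ ξ⁻¹ ν Cf (z - x) * M₃ z x)) ∧
      |∑' x : ZSite 3, ξ ^ 3 * (pdiffAdjZ ξ⁻¹ ν Cf (z - x) * M₃ z x)| ≤ C * K * (833 / δ ^ 3) := by
  obtain ⟨hsP, hbP⟩ := summable_prof_sub hξ hξ1 hδ hδ1 (le_refl 2) z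
  have hpt : ∀ x : ZSite 3, |ξ ^ 3 * (pdiffAdjZ ξ⁻¹ ν Cf (z - x) * M₃ z x)| ≤ C * K * (ξ ^ 3 * prof ξ δ 2 (x - z)) := by
    intro x
    rw [abs_mul, abs_of_pos (pow_pos hξ 3), abs_mul, prof_sub_comm ξ δ 2 x z]
    have h1 := hCx2a ν (z - x)
    have h2 := hM3 z x
    have hp := prof_nonneg hξ.le δ 2 (z - x)
    calc ξ ^ 3 * (|pdiffAdjZ ξ⁻¹ ν Cf (z - x)| * |M₃ z x|) ≤ ξ ^ 3 * ((C * prof ξ δ 2 (z - x)) * K) :=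
          mul_le_mul_of_nonneg_left (mul_le_mul h1 h2 (abs_nonneg _) (by positivity)) (pow_pos hξ 3).le
      _ = C * K * (ξ ^ 3 * prof ξ δ 2 (z - x)) := by ring
  have hs : Summable (fun x : ZSite 3 => ξ ^ 3 * (pdiffAdjZ ξ⁻¹ ν Cf (z - x) * M₃ z x)) :=
    (Summable.of_nonneg_of_le (fun x => abs_nonneg _) hpt (hsP.mul_left _)).of_abs
  refine ⟨hs, (abs_tsum_le_tsum_of_abs_le hs (hsP.mul_left _) hpt).trans ?_⟩
  rw [tsum_mul_left]
  exact mul_le_mul_of_nonneg_left hbP (by positivity)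

/-- **the loop term `(M₂∂^*_ν)·G₃` is bounded uniformly** — by the Fubini clause for `M₂∂^*` at rate `δ/2` (the `x`-sum performed
inside the convolution defining `M₂∂^*`; the leg `G₃(z,·)` has the law `C·P₁^δ ≤ C(1+2/δ)·P₂^{δ/2}`).
[cite: Balaban1983Higgs3, p.444] -/
theorem abs_loopMG_le (hξ : 0 < ξ) (hξ1 : ξ ≤ 1) (hδ : 0 < δ) (hC : 0 ≤ C) {K₂ : ℝ}
    {M₂ G₃ : ZSite 3 → ZSite 3 → ℝ} (hG3 : ∀ y x, |G₃ y x| ≤ C * prof ξ δ 1 (y - x))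
    (hF2h : ∀ (μ' : Fin 3) (y : ZSite 3) (κ : ZSite 3 → ℝ) (b : ℝ), 0 ≤ b →
      (∀ x', |κ x'| ≤ b * prof ξ (δ / 2) 2 (x' - y)) →
      Summable (fun x' => ξ ^ 3 * (dK2 ξ μ' M₂ y x' * κ x')) ∧
        |∑' x', ξ ^ 3 * (dK2 ξ μ' M₂ y x' * κ x')| ≤ K₂ * b)
    (ν : Fin 3) (z : ZSite 3) :
    Summable (fun x : ZSite 3 => ξ ^ 3 * (dK2 ξ ν M₂ z x * G₃ z x)) ∧
      |∑' x : ZSite 3, ξ ^ 3 * (dK2 ξ ν M₂ z x * G₃ z x)| ≤ K₂ * (C * (1 + 2 / δ)) := by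
  have hκ : ∀ x : ZSite 3, |G₃ z x| ≤ C * (1 + 2 / δ) * prof ξ (δ / 2) 2 (x - z) := by
    intro x
    refine (hG3 z x).trans ?_
    rw [prof_sub_comm ξ δ 1 z x, mul_assoc]
    exact mul_le_mul_of_nonneg_left (profile_one_le_two_half hξ hξ1 hδ (x - z)) hC
  exact hF2h ν z (fun x => G₃ z x) (C * (1 + 2 / δ)) (by positivity) hκ

/-- **THE LOOP SPLITS** as `B[G₂,G₃](z) = Σ'_uξ³(∂^{ξ*}_νC)(u)C(u) + B[C,M₃](z) + B[M₂,G₃](z)` — the `z`-independent pure-`C`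
loop plus the two terms carrying a difference kernel (each series absolutely convergent). [cite: Balaban1983Higgs3, p.444] -/
theorem loop221c_eq_split (hξ : 0 < ξ) (hξ1 : ξ ≤ 1) (hδ : 0 < δ) (hδ1 : δ ≤ 1) (hC : 0 ≤ C) (hK : 0 ≤ K) {K₂ : ℝ}
    {Cf : ZSite 3 → ℝ} {G₂ M₂ G₃ M₃ : ZSite 3 → ZSite 3 → ℝ} (hCs : Summable Cf)
    (hG2 : ∀ y x, G₂ y x = Cf (y - x) + M₂ y x) (hG3e : ∀ y x, G₃ y x = Cf (y - x) + M₃ y x)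
    (hCx1 : ∀ u, |Cf u| ≤ C * prof ξ δ 1 u)
    (hCx2a : ∀ (μ : Fin 3) (u : ZSite 3), |pdiffAdjZ ξ⁻¹ μ Cf u| ≤ C * prof ξ δ 2 u)
    (hG3 : ∀ y x, |G₃ y x| ≤ C * prof ξ δ 1 (y - x)) (hM3 : ∀ y y', |M₃ y y'| ≤ K)
    (hF2h : ∀ (μ' : Fin 3) (y : ZSite 3) (κ : ZSite 3 → ℝ) (b : ℝ), 0 ≤ b →
      (∀ x', |κ x'| ≤ b * prof ξ (δ / 2) 2 (x' - y)) →
      Summable (fun x' => ξ ^ 3 * (dK2 ξ μ' M₂ y x' * κ x')) ∧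
        |∑' x', ξ ^ 3 * (dK2 ξ μ' M₂ y x' * κ x')| ≤ K₂ * b)
    (ν : Fin 3) (z : ZSite 3) :
    loop221c ξ ν G₂ G₃ z = (∑' u : ZSite 3, ξ ^ 3 * (pdiffAdjZ ξ⁻¹ ν Cf u * Cf u)) +
      loop221c ξ ν (convK Cf) M₃ z + loop221c ξ ν M₂ G₃ z := by
  have hCb : ∃ B, ∀ u, |Cf u| ≤ B := by
    refine ⟨C * (ξ ^ 1)⁻¹, fun u => (hCx1 u).trans (mul_le_mul_of_nonneg_left ?_ hC)⟩
    exact profile_le_inv_pow hξ hδ.le 1 u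
  obtain ⟨hs1, -⟩ := abs_loopCC_le hξ hδ.le hC hCs hCb hCx2a ν
  obtain ⟨hs2, -⟩ := abs_loopCM_le hξ hξ1 hδ hδ1 hC hK hCx2a hM3 ν z
  obtain ⟨hs3, -⟩ := abs_loopMG_le hξ hξ1 hδ hC hG3 hF2h ν z
  have hs1z : Summable (fun x : ZSite 3 => ξ ^ 3 * (pdiffAdjZ ξ⁻¹ ν Cf (z - x) * Cf (z - x))) :=
    (Equiv.subLeft z).summable_iff.2 hs1
  have e1z : ∑' x : ZSite 3, ξ ^ 3 * (pdiffAdjZ ξ⁻¹ ν Cf (z - x) * Cf (z - x)) =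
      ∑' u : ZSite 3, ξ ^ 3 * (pdiffAdjZ ξ⁻¹ ν Cf u * Cf u) := by
    have h := (Equiv.subLeft z).tsum_eq (fun u : ZSite 3 => ξ ^ 3 * (pdiffAdjZ ξ⁻¹ ν Cf u * Cf u))
    simp only [Equiv.subLeft_apply] at h
    exact h
  have hsplit : ∀ x : ZSite 3, ξ ^ 3 * (dK2 ξ ν G₂ z x * G₃ z x) =
      ξ ^ 3 * (pdiffAdjZ ξ⁻¹ ν Cf (z - x) * Cf (z - x)) + ξ ^ 3 * (pdiffAdjZ ξ⁻¹ ν Cf (z - x) * M₃ z x) +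
        ξ ^ 3 * (dK2 ξ ν M₂ z x * G₃ z x) := fun x => loop_summand_split ξ ν hG2 hG3e z x
  have hCM : ∀ x : ZSite 3, ξ ^ 3 * (dK2 ξ ν (convK Cf) z x * M₃ z x) =
      ξ ^ 3 * (pdiffAdjZ ξ⁻¹ ν Cf (z - x) * M₃ z x) := fun x => by rw [dK2_convK]
  unfold loop221c
  rw [tsum_congr hsplit, (hs1z.add hs2).tsum_add hs3, hs1z.tsum_add hs2, e1z, tsum_congr hCM]

/-- **THE LOOP OF (2.21c) IS BOUNDED UNIFORMLY in the vertex and the spacing**: `|B_ν[G₂,G₃](z)| ≤ Λ₀ = ½C²·53 + CK·833/δ³ +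
K₂C(1+2/δ)` and its series converges absolutely, for loop lines `G_i = C + M_i` with the propagator laws, `|M₃| ≤ K` and the
Fubini clause for `M₂∂^*` — although the loop is of degree `0` (`Σξ³P₂P₁ ~ log ξ^{−1}`). [cite: Balaban1983Higgs3, p.444] -/
theorem abs_loop221c_le (hξ : 0 < ξ) (hξ1 : ξ ≤ 1) (hδ : 0 < δ) (hδ1 : δ ≤ 1) (hC : 0 ≤ C) (hK : 0 ≤ K) {K₂ : ℝ}
    {Cf : ZSite 3 → ℝ} {G₂ M₂ G₃ M₃ : ZSite 3 → ZSite 3 → ℝ} (hCs : Summable Cf)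
    (hG2 : ∀ y x, G₂ y x = Cf (y - x) + M₂ y x) (hG3e : ∀ y x, G₃ y x = Cf (y - x) + M₃ y x)
    (hCx1 : ∀ u, |Cf u| ≤ C * prof ξ δ 1 u)
    (hCx2a : ∀ (μ : Fin 3) (u : ZSite 3), |pdiffAdjZ ξ⁻¹ μ Cf u| ≤ C * prof ξ δ 2 u)
    (hG3 : ∀ y x, |G₃ y x| ≤ C * prof ξ δ 1 (y - x)) (hM3 : ∀ y y', |M₃ y y'| ≤ K)
    (hF2h : ∀ (μ' : Fin 3) (y : ZSite 3) (κ : ZSite 3 → ℝ) (b : ℝ), 0 ≤ b →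
      (∀ x', |κ x'| ≤ b * prof ξ (δ / 2) 2 (x' - y)) →
      Summable (fun x' => ξ ^ 3 * (dK2 ξ μ' M₂ y x' * κ x')) ∧
        |∑' x', ξ ^ 3 * (dK2 ξ μ' M₂ y x' * κ x')| ≤ K₂ * b)
    (ν : Fin 3) (z : ZSite 3) :
    Summable (fun x : ZSite 3 => ξ ^ 3 * (dK2 ξ ν G₂ z x * G₃ z x)) ∧
      |loop221c ξ ν G₂ G₃ z| ≤ 1 / 2 * C ^ 2 * 53 + C * K * (833 / δ ^ 3) + K₂ * (C * (1 + 2 / δ)) := by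
  have hCb : ∃ B, ∀ u, |Cf u| ≤ B := by
    refine ⟨C * (ξ ^ 1)⁻¹, fun u => (hCx1 u).trans (mul_le_mul_of_nonneg_left ?_ hC)⟩
    exact profile_le_inv_pow hξ hδ.le 1 u
  obtain ⟨hs1, hb1⟩ := abs_loopCC_le hξ hδ.le hC hCs hCb hCx2a ν
  obtain ⟨hs2, hb2⟩ := abs_loopCM_le hξ hξ1 hδ hδ1 hC hK hCx2a hM3 ν z
  obtain ⟨hs3, hb3⟩ := abs_loopMG_le hξ hξ1 hδ hC hG3 hF2h ν z
  have hs1z : Summable (fun x : ZSite 3 => ξ ^ 3 * (pdiffAdjZ ξ⁻¹ ν Cf (z - x) * Cf (z - x))) :=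
    (Equiv.subLeft z).summable_iff.2 hs1
  have hsplit : ∀ x : ZSite 3, ξ ^ 3 * (dK2 ξ ν G₂ z x * G₃ z x) =
      ξ ^ 3 * (pdiffAdjZ ξ⁻¹ ν Cf (z - x) * Cf (z - x)) + ξ ^ 3 * (pdiffAdjZ ξ⁻¹ ν Cf (z - x) * M₃ z x) +
        ξ ^ 3 * (dK2 ξ ν M₂ z x * G₃ z x) := fun x => loop_summand_split ξ ν hG2 hG3e z x
  have hCM : loop221c ξ ν (convK Cf) M₃ z = ∑' x : ZSite 3, ξ ^ 3 * (pdiffAdjZ ξ⁻¹ ν Cf (z - x) * M₃ z x) := by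
    unfold loop221c; exact tsum_congr fun x => by rw [dK2_convK]
  refine ⟨((hs1z.add hs2).add hs3).congr fun x => (hsplit x).symm, ?_⟩
  rw [loop221c_eq_split hξ hξ1 hδ hδ1 hC hK hCs hG2 hG3e hCx1 hCx2a hG3 hM3 hF2h ν z, hCM]
  exact (abs_add_le _ _).trans (add_le_add ((abs_add_le _ _).trans (add_le_add hb1 hb2)) hb3)

/-- **THE TERM WITH THE DIFFERENCE KERNEL ON THE DIFFERENTIATED LINE is convergent**: `|F[M₁,G₂,G₃](x′)| =
|Σ'_zξ³Σ_ν(∂_μM₁∂^*_ν)(x′,z)B_ν[G₂,G₃](z)| ≤ 3KΛ₀·833/(δ/2)³` — the mixed difference of `M₁` has the law of an UNDIFFERENTIATED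
propagator (`K·P₁^{δ/2}`, summable against `ξ³`) and the loop is bounded by `Λ₀`. [cite: Balaban1983Higgs3, p.444] -/
theorem abs_fac221c_M_le (hξ : 0 < ξ) (hξ1 : ξ ≤ 1) (hδ : 0 < δ) (hδ1 : δ ≤ 1) (hK : 0 ≤ K) {Λ₀ : ℝ} (hΛ₀ : 0 ≤ Λ₀)
    {M₁ G₂ G₃ : ZSite 3 → ZSite 3 → ℝ}
    (hM1d2 : ∀ (μ' μ : Fin 3) (x y : ZSite 3), |d2K ξ μ' μ M₁ x y| ≤ K * prof ξ (δ / 2) 1 (x - y))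
    (hloop : ∀ (ν : Fin 3) (z : ZSite 3), |loop221c ξ ν G₂ G₃ z| ≤ Λ₀) (μ : Fin 3) (x' : ZSite 3) :
    Summable (fun z : ZSite 3 => ξ ^ 3 * ∑ ν : Fin 3, d2K ξ μ ν M₁ x' z * loop221c ξ ν G₂ G₃ z) ∧
      |fac221c ξ μ M₁ G₂ G₃ x'| ≤ 3 * K * Λ₀ * (833 / (δ / 2) ^ 3) := by
  have hδ' : 0 < δ / 2 := by linarith
  have hδ'1 : δ / 2 ≤ 1 := by linarith
  obtain ⟨hsP, hbP⟩ := summable_prof_sub hξ hξ1 hδ' hδ'1 (by norm_num : 1 ≤ 2) x'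
  have hpt : ∀ z : ZSite 3, |ξ ^ 3 * ∑ ν : Fin 3, d2K ξ μ ν M₁ x' z * loop221c ξ ν G₂ G₃ z| ≤
      3 * K * Λ₀ * (ξ ^ 3 * prof ξ (δ / 2) 1 (z - x')) := by
    intro z
    rw [abs_mul, abs_of_pos (pow_pos hξ 3), prof_sub_comm ξ (δ / 2) 1 z x']
    have hterm : ∀ ν : Fin 3, |d2K ξ μ ν M₁ x' z * loop221c ξ ν G₂ G₃ z| ≤ K * prof ξ (δ / 2) 1 (x' - z) * Λ₀ := by
      intro ν
      rw [abs_mul]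
      exact mul_le_mul (hM1d2 μ ν x' z) (hloop ν z) (abs_nonneg _)
        (by have := prof_nonneg hξ.le (δ / 2) 1 (x' - z); positivity)
    have hsum : |∑ ν : Fin 3, d2K ξ μ ν M₁ x' z * loop221c ξ ν G₂ G₃ z| ≤ 3 * (K * prof ξ (δ / 2) 1 (x' - z) * Λ₀) := by
      refine (abs_sum_le_sum_abs _ _).trans ?_
      calc ∑ ν : Fin 3, |d2K ξ μ ν M₁ x' z * loop221c ξ ν G₂ G₃ z|
          ≤ ∑ _ν : Fin 3, K * prof ξ (δ / 2) 1 (x' - z) * Λ₀ := sum_le_sum fun ν _ => hterm ν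
        _ = 3 * (K * prof ξ (δ / 2) 1 (x' - z) * Λ₀) := by simp [sum_const, card_univ, Fintype.card_fin]
    calc ξ ^ 3 * |∑ ν : Fin 3, d2K ξ μ ν M₁ x' z * loop221c ξ ν G₂ G₃ z|
        ≤ ξ ^ 3 * (3 * (K * prof ξ (δ / 2) 1 (x' - z) * Λ₀)) := mul_le_mul_of_nonneg_left hsum (pow_pos hξ 3).le
      _ = 3 * K * Λ₀ * (ξ ^ 3 * prof ξ (δ / 2) 1 (x' - z)) := by ring
  have hs : Summable (fun z : ZSite 3 => ξ ^ 3 * ∑ ν : Fin 3, d2K ξ μ ν M₁ x' z * loop221c ξ ν G₂ G₃ z) :=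
    (Summable.of_nonneg_of_le (fun z => abs_nonneg _) hpt (hsP.mul_left _)).of_abs
  refine ⟨hs, ?_⟩
  unfold fac221c
  refine (abs_tsum_le_tsum_of_abs_le hs (hsP.mul_left _) hpt).trans ?_
  rw [tsum_mul_left]
  exact mul_le_mul_of_nonneg_left hbP (by positivity)

/-- kernel: a profile centred at `y′` WITHOUT the volume factor is summable (for each spacing). [cite: Balaban1983Higgs3, (3.16) p.437] -/
theorem summable_prof_sub' (hξ : 0 < ξ) (hξ1 : ξ ≤ 1) (hδ : 0 < δ) (hδ1 : δ ≤ 1) {q : ℕ} (hq : q ≤ 2) (y' : ZSite 3) :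
    Summable (fun y : ZSite 3 => prof ξ δ q (y - y')) := by
  have h := (summable_prof_sub hξ hξ1 hδ hδ1 hq y').1.mul_left ((ξ ^ 3)⁻¹)
  refine h.congr fun y => ?_
  rw [← mul_assoc, inv_mul_cancel₀ (pow_ne_zero 3 hξ.ne'), one_mul]

/-- **THE LATTICE DERIVATIVE OF THE LOOP TERM `(M₂∂^*_ν)·G₃`** (plain difference in the vertex):
`B[M₂,G₃](w+e_ρ) − B[M₂,G₃](w) = ξ·Σ'_xξ³[(∂_ρM₂∂^*_ν)(w,x)G₃(w+e_ρ,x) + (M₂∂^*_ν)(w,x)(∂_ρG₃)(w,x)]`, the first sum bounded by the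
mixed-difference law of `M₂` against the value law of `G₃` (a `P₁·P₁` pair sum), the second by the Fubini clause for `M₂∂^*` against
the once-differentiated leg `∂_ρG₃`: `|B[M₂,G₃](w+e_ρ) − B[M₂,G₃](w)| ≤ ξ·(2eCK·833/(δ/2)³ + KC)`. [cite: Balaban1983Higgs3, p.444] -/
theorem abs_loopMG_diff_le (hξ : 0 < ξ) (hξ1 : ξ ≤ 1) (hδ : 0 < δ) (hδ1 : δ ≤ 1) (hC : 0 ≤ C) (hK : 0 ≤ K) {K₂ : ℝ}
    {M₂ G₃ : ZSite 3 → ZSite 3 → ℝ} (hG3 : ∀ y x, |G₃ y x| ≤ C * prof ξ δ 1 (y - x))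
    (hG3d : ∀ (μ : Fin 3) (y x : ZSite 3), |dK1 ξ μ G₃ y x| ≤ C * prof ξ δ 2 (y - x))
    (hM2d2 : ∀ (μ' μ : Fin 3) (x y : ZSite 3), |d2K ξ μ' μ M₂ x y| ≤ K * prof ξ (δ / 2) 1 (x - y))
    (hF2 : ∀ (μ' : Fin 3) (y : ZSite 3) (κ : ZSite 3 → ℝ) (b : ℝ), 0 ≤ b →
      (∀ x', |κ x'| ≤ b * prof ξ δ 2 (x' - y)) →
      Summable (fun x' => ξ ^ 3 * (dK2 ξ μ' M₂ y x' * κ x')) ∧ |∑' x', ξ ^ 3 * (dK2 ξ μ' M₂ y x' * κ x')| ≤ K * b)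
    (hF2h : ∀ (μ' : Fin 3) (y : ZSite 3) (κ : ZSite 3 → ℝ) (b : ℝ), 0 ≤ b →
      (∀ x', |κ x'| ≤ b * prof ξ (δ / 2) 2 (x' - y)) →
      Summable (fun x' => ξ ^ 3 * (dK2 ξ μ' M₂ y x' * κ x')) ∧ |∑' x', ξ ^ 3 * (dK2 ξ μ' M₂ y x' * κ x')| ≤ K₂ * b)
    (ν ρ : Fin 3) (w : ZSite 3) :
    |loop221c ξ ν M₂ G₃ (w + unitVec ρ) - loop221c ξ ν M₂ G₃ w| ≤
      ξ * (2 * Real.exp 1 * C * K * (833 / (δ / 2) ^ 3) + K * C) := by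
  have hδ' : 0 < δ / 2 := by linarith
  have hδ'1 : δ / 2 ≤ 1 := by linarith
  set e := unitVec ρ with he
  obtain ⟨hsA, -⟩ := abs_loopMG_le hξ hξ1 hδ hC hG3 hF2h ν (w + e)
  obtain ⟨hsB, -⟩ := abs_loopMG_le hξ hξ1 hδ hC hG3 hF2h ν w
  -- the two families of the difference
  set α : ZSite 3 → ℝ := fun x => ξ ^ 3 * (d2K ξ ρ ν M₂ w x * G₃ (w + e) x) with hα
  set β : ZSite 3 → ℝ := fun x => ξ ^ 3 * (dK2 ξ ν M₂ w x * dK1 ξ ρ G₃ w x) with hβ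
  have hpt : ∀ x : ZSite 3, ξ ^ 3 * (dK2 ξ ν M₂ (w + e) x * G₃ (w + e) x) - ξ ^ 3 * (dK2 ξ ν M₂ w x * G₃ w x) =
      ξ * (α x + β x) := by
    intro x
    simp only [hα, hβ, d2K, dK2, dK1, he]
    field_simp
    ring
  -- term α: `|α x| ≤ 2eCK·ξ³P₁^{δ/2}(w−x)P₁^{δ/2}(x−w)`
  obtain ⟨hsαP, hbαP⟩ := tsum_profile_one_mul_le hξ hξ1 hδ' hδ'1 w w
  have hptα : ∀ x : ZSite 3, |α x| ≤ 2 * Real.exp 1 * C * K *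
      (ξ ^ 3 * (prof ξ (δ / 2) 1 (w - x) * prof ξ (δ / 2) 1 (x - w))) := by
    intro x
    simp only [hα]
    rw [abs_mul, abs_of_pos (pow_pos hξ 3), abs_mul]
    have h1 := hM2d2 ρ ν w x
    have h2 : |G₃ (w + e) x| ≤ 2 * Real.exp 1 * C * prof ξ (δ / 2) 1 (x - w) := by
      refine (hG3 (w + e) x).trans ?_
      rw [show w + e - x = (w - x) + e by abel]
      have hs := prof_shift_le hξ hξ1 hδ.le hδ1 1 (w - x) e (by rw [he]; exact (supNorm_unitVec ρ).1.le)
      have hm := prof_mono_rate hξ.le (by linarith : δ / 2 ≤ δ) 1 (w - x)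
      rw [prof_sub_comm ξ (δ / 2) 1 x w]
      calc C * prof ξ δ 1 (w - x + e) ≤ C * (2 ^ 1 * Real.exp 1 * prof ξ δ 1 (w - x)) :=
            mul_le_mul_of_nonneg_left hs hC
        _ ≤ C * (2 ^ 1 * Real.exp 1 * prof ξ (δ / 2) 1 (w - x)) := by gcongr
        _ = 2 * Real.exp 1 * C * prof ξ (δ / 2) 1 (w - x) := by ring
    have hp1 := prof_nonneg hξ.le (δ / 2) 1 (w - x)
    calc ξ ^ 3 * (|d2K ξ ρ ν M₂ w x| * |G₃ (w + e) x|)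
        ≤ ξ ^ 3 * ((K * prof ξ (δ / 2) 1 (w - x)) * (2 * Real.exp 1 * C * prof ξ (δ / 2) 1 (x - w))) :=
          mul_le_mul_of_nonneg_left (mul_le_mul h1 h2 (abs_nonneg _) (by positivity)) (pow_pos hξ 3).le
      _ = 2 * Real.exp 1 * C * K * (ξ ^ 3 * (prof ξ (δ / 2) 1 (w - x) * prof ξ (δ / 2) 1 (x - w))) := by ring
  have hsα : Summable α := (Summable.of_nonneg_of_le (fun x => abs_nonneg _) hptα (hsαP.mul_left _)).of_abs
  have hbα : |∑' x, α x| ≤ 2 * Real.exp 1 * C * K * (833 / (δ / 2) ^ 3) := by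
    refine (abs_tsum_le_tsum_of_abs_le hsα (hsαP.mul_left _) hptα).trans ?_
    rw [tsum_mul_left]
    exact mul_le_mul_of_nonneg_left hbαP (by positivity)
  -- term β: Fubini for `M₂∂^*` against `∂_ρG₃(w,·)`
  have hκ : ∀ x : ZSite 3, |dK1 ξ ρ G₃ w x| ≤ C * prof ξ δ 2 (x - w) := fun x => by
    rw [prof_sub_comm ξ δ 2 x w]; exact hG3d ρ w x
  obtain ⟨hsβ, hbβ⟩ := hF2 ν w (fun x => dK1 ξ ρ G₃ w x) C hC hκ
  -- assemble
  unfold loop221c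
  rw [← hsA.tsum_sub hsB, tsum_congr hpt, tsum_mul_left, hsα.tsum_add hsβ, abs_mul, abs_of_pos hξ]
  refine mul_le_mul_of_nonneg_left ((abs_add_le _ _).trans (add_le_add hbα hbβ)) hξ.le

/-- **THE LOOP TERM `(∂^{ξ*}_νC)·M₃` AFTER SUMMATION BY PARTS IN `x″`**: `B[C,M₃](w) = −Σ'_x ξ³ C(w−x)·(M₃∂^{ξ*}_ν)(w, x−e_ν)` —
the lattice difference moved from the translation-invariant line onto the difference kernel (`C` summable with a value law,
`|M₃| ≤ K`). [cite: Balaban1983Higgs3, p.444] -/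
theorem loop_convK_M_eq_sbp (hξ : 0 < ξ) (hξ1 : ξ ≤ 1) (hδ : 0 < δ) (hδ1 : δ ≤ 1) (hC : 0 ≤ C) {Cf : ZSite 3 → ℝ}
    {M₃ : ZSite 3 → ZSite 3 → ℝ} (hCx1 : ∀ u, |Cf u| ≤ C * prof ξ δ 1 u) (hM3 : ∀ y y', |M₃ y y'| ≤ K)
    (ν : Fin 3) (w : ZSite 3) :
    loop221c ξ ν (convK Cf) M₃ w = -∑' x : ZSite 3, ξ ^ 3 * (Cf (w - x) * dK2 ξ ν M₃ w (x - unitVec ν)) := by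
  set e := unitVec ν with he
  set f : ZSite 3 → ℝ := fun x => Cf (w - x) with hf
  set g : ZSite 3 → ℝ := fun x => M₃ w x with hg
  have hK0 : 0 ≤ K := (abs_nonneg _).trans (hM3 w w)
  -- summability of `f(·+s)·g` for any shift `s`
  have hsfg : ∀ s : ZSite 3, Summable fun x : ZSite 3 => f (x + s) * g x := by
    intro s
    have hP := summable_prof_sub' hξ hξ1 hδ hδ1 (by norm_num : 1 ≤ 2) (w - s)
    refine Summable.of_norm_bounded (g := fun x => C * K * prof ξ δ 1 (x - (w - s))) (hP.mul_left _) fun x => ?_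
    rw [Real.norm_eq_abs, abs_mul]
    have h1 : |f (x + s)| ≤ C * prof ξ δ 1 (x - (w - s)) := by
      simp only [hf]
      rw [prof_sub_comm ξ δ 1 x (w - s), show w - s - x = w - (x + s) by abel]
      exact hCx1 _
    have hp := prof_nonneg hξ.le δ 1 (x - (w - s))
    calc |f (x + s)| * |g x| ≤ (C * prof ξ δ 1 (x - (w - s))) * K :=
          mul_le_mul h1 (hM3 w x) (abs_nonneg _) (by positivity)
      _ = C * K * prof ξ δ 1 (x - (w - s)) := by ring
  have h1 : Summable fun x : ZSite 3 => f (x + e) * g x := hsfg e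
  have h2 : Summable fun x : ZSite 3 => f x * g x := by simpa using hsfg 0
  have hpt : ∀ x : ZSite 3, ξ ^ 3 * (dK2 ξ ν (convK Cf) w x * M₃ w x) = ξ ^ 2 * ((f (x + e) - f x) * g x) := by
    intro x
    simp only [dK2, convK, hf, hg, he]
    have hξ0 : ξ ≠ 0 := hξ.ne'
    field_simp
  have hpt2 : ∀ x : ZSite 3, f x * (g (x - e) - g x) = -ξ * (Cf (w - x) * dK2 ξ ν M₃ w (x - e)) := by
    intro x
    simp only [hf, hg, dK2, he, sub_add_cancel]
    have hξ0 : ξ ≠ 0 := hξ.ne'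
    field_simp
    ring
  unfold loop221c
  rw [tsum_congr hpt, tsum_mul_left, tsum_fwdDiff_mul e h1 h2, tsum_congr hpt2, tsum_mul_left, tsum_mul_left]
  ring

/-- **THE LATTICE DERIVATIVE OF THE LOOP TERM `(∂^{ξ*}_νC)·M₃`**: from the summation-by-parts form,
`B[C,M₃](w+e_ρ) − B[C,M₃](w) = −ξ·Σ'_xξ³[(∂^ξ_ρC)(w−x)(M₃∂^*_ν)(w+e_ρ,x−e_ν) + C(w−x)(∂_ρM₃∂^*_ν)(w,x−e_ν)]`; the first sum by the
Fubini clause for `M₃∂^*` (centre `w+e_ρ`; the leg `∂_ρC` re-centred by two unit shifts, factor `(4e)²`), the second by the value law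
of `C` against the mixed-difference law of `M₃` (a `P₁·P₁` pair sum): `|B[C,M₃](w+e_ρ) − B[C,M₃](w)| ≤ ξ·(16e²CK +
2eCK·833/(δ/2)³)`. [cite: Balaban1983Higgs3, p.444] -/
theorem abs_loopCM_diff_le (hξ : 0 < ξ) (hξ1 : ξ ≤ 1) (hδ : 0 < δ) (hδ1 : δ ≤ 1) (hC : 0 ≤ C) (hK : 0 ≤ K)
    {Cf : ZSite 3 → ℝ} {M₃ : ZSite 3 → ZSite 3 → ℝ} (hCx1 : ∀ u, |Cf u| ≤ C * prof ξ δ 1 u)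
    (hCx2 : ∀ (μ : Fin 3) (u : ZSite 3), |pdiffZ ξ⁻¹ μ Cf u| ≤ C * prof ξ δ 2 u) (hM3 : ∀ y y', |M₃ y y'| ≤ K)
    (hM3d1 : ∀ (μ : Fin 3) (y x : ZSite 3), |dK2 ξ μ M₃ y x| ≤ ξ⁻¹ * K)
    (hM3d2 : ∀ (μ' μ : Fin 3) (x y : ZSite 3), |d2K ξ μ' μ M₃ x y| ≤ K * prof ξ (δ / 2) 1 (x - y))
    (hF3 : ∀ (μ' : Fin 3) (y : ZSite 3) (κ : ZSite 3 → ℝ) (b : ℝ), 0 ≤ b →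
      (∀ x', |κ x'| ≤ b * prof ξ δ 2 (x' - y)) →
      Summable (fun x' => ξ ^ 3 * (dK2 ξ μ' M₃ y x' * κ x')) ∧ |∑' x', ξ ^ 3 * (dK2 ξ μ' M₃ y x' * κ x')| ≤ K * b)
    (ν ρ : Fin 3) (w : ZSite 3) :
    |loop221c ξ ν (convK Cf) M₃ (w + unitVec ρ) - loop221c ξ ν (convK Cf) M₃ w| ≤
      ξ * (K * (16 * Real.exp 1 ^ 2 * C) + 2 * Real.exp 1 * C * K * (833 / (δ / 2) ^ 3)) := by
  have hδ' : 0 < δ / 2 := by linarith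
  have hδ'1 : δ / 2 ≤ 1 := by linarith
  rw [loop_convK_M_eq_sbp hξ hξ1 hδ hδ1 hC hCx1 hM3 ν (w + unitVec ρ), loop_convK_M_eq_sbp hξ hξ1 hδ hδ1 hC hCx1 hM3 ν w]
  -- the two families of the summation-by-parts form, at `w + e_ρ` and at `w`, are summable (for each spacing)
  have hsS : ∀ w' : ZSite 3, Summable fun x : ZSite 3 => ξ ^ 3 * (Cf (w' - x) * dK2 ξ ν M₃ w' (x - unitVec ν)) := by
    intro w'
    have hP := summable_prof_sub hξ hξ1 hδ hδ1 (by norm_num : 1 ≤ 2) w'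
    refine Summable.of_norm_bounded (g := fun x => C * (ξ⁻¹ * K) * (ξ ^ 3 * prof ξ δ 1 (x - w')))
      (hP.1.mul_left _) fun x => ?_
    rw [Real.norm_eq_abs, abs_mul, abs_of_pos (pow_pos hξ 3), abs_mul]
    have h1 : |Cf (w' - x)| ≤ C * prof ξ δ 1 (x - w') := by rw [prof_sub_comm ξ δ 1 x w']; exact hCx1 _
    have hp := prof_nonneg hξ.le δ 1 (x - w')
    calc ξ ^ 3 * (|Cf (w' - x)| * |dK2 ξ ν M₃ w' (x - unitVec ν)|) ≤ ξ ^ 3 * ((C * prof ξ δ 1 (x - w')) * (ξ⁻¹ * K)) :=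
          mul_le_mul_of_nonneg_left (mul_le_mul h1 (hM3d1 ν w' _) (abs_nonneg _) (by positivity)) (pow_pos hξ 3).le
      _ = C * (ξ⁻¹ * K) * (ξ ^ 3 * prof ξ δ 1 (x - w')) := by ring
  -- the two families of the difference
  set γ : ZSite 3 → ℝ := fun x => ξ ^ 3 * (dK2 ξ ν M₃ (w + unitVec ρ) (x - unitVec ν) * pdiffZ ξ⁻¹ ρ Cf (w - x)) with hγ
  set θ : ZSite 3 → ℝ := fun x => ξ ^ 3 * (Cf (w - x) * d2K ξ ρ ν M₃ w (x - unitVec ν)) with hθ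
  have hpt : ∀ x : ZSite 3, ξ ^ 3 * (Cf (w + unitVec ρ - x) * dK2 ξ ν M₃ (w + unitVec ρ) (x - unitVec ν)) -
      ξ ^ 3 * (Cf (w - x) * dK2 ξ ν M₃ w (x - unitVec ν)) = ξ * (γ x + θ x) := by
    intro x
    simp only [hγ, hθ, d2K, dK2, pdiffZ]
    rw [show w + unitVec ρ - x = w - x + unitVec ρ by abel]
    have hξ0 : ξ ≠ 0 := hξ.ne'
    field_simp
    ring
  -- term γ: Fubini for `M₃∂^*` (first argument `w + e_ρ`) against `v ↦ (∂_ρC)(w − v − e_ν)`, re-indexed `v = x − e_ν`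
  set κ : ZSite 3 → ℝ := fun v => pdiffZ ξ⁻¹ ρ Cf (w - (v + unitVec ν)) with hκ
  have hκb : ∀ v : ZSite 3, |κ v| ≤ 16 * Real.exp 1 ^ 2 * C * prof ξ δ 2 (v - (w + unitVec ρ)) := by
    intro v
    simp only [hκ]
    refine (hCx2 ρ _).trans ?_
    have e1 : w - (v + unitVec ν) = -((v - (w + unitVec ρ)) + unitVec ρ + unitVec ν) := by abel
    rw [e1, show prof ξ δ 2 (-((v - (w + unitVec ρ)) + unitVec ρ + unitVec ν)) = prof ξ δ 2 ((v - (w + unitVec ρ)) + unitVec ρ + unitVec ν) by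
      unfold prof; rw [supNorm_neg]]
    have hs1 := prof_shift_le hξ hξ1 hδ.le hδ1 2 ((v - (w + unitVec ρ)) + unitVec ρ) (unitVec ν) (supNorm_unitVec ν).1.le
    have hs2 := prof_shift_le hξ hξ1 hδ.le hδ1 2 (v - (w + unitVec ρ)) (unitVec ρ) (supNorm_unitVec ρ).1.le
    have he0 : 0 ≤ Real.exp 1 := (Real.exp_pos 1).le
    calc C * prof ξ δ 2 (v - (w + unitVec ρ) + unitVec ρ + unitVec ν) ≤ C * (2 ^ 2 * Real.exp 1 * prof ξ δ 2 (v - (w + unitVec ρ) + unitVec ρ)) :=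
          mul_le_mul_of_nonneg_left hs1 hC
      _ ≤ C * (2 ^ 2 * Real.exp 1 * (2 ^ 2 * Real.exp 1 * prof ξ δ 2 (v - (w + unitVec ρ)))) := by gcongr
      _ = 16 * Real.exp 1 ^ 2 * C * prof ξ δ 2 (v - (w + unitVec ρ)) := by ring
  obtain ⟨hsγv, hbγv⟩ := hF3 ν (w + unitVec ρ) κ (16 * Real.exp 1 ^ 2 * C) (by positivity) hκb
  have hγre : ∀ x : ZSite 3, γ x = (fun v => ξ ^ 3 * (dK2 ξ ν M₃ (w + unitVec ρ) v * κ v)) (x - unitVec ν) := by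
    intro x; simp only [hγ, hκ, sub_add_cancel]
  have hsγ : Summable γ := by
    have h := (Equiv.subRight (unitVec ν)).summable_iff.2 hsγv
    exact h.congr fun x => (hγre x).symm
  have heγ : ∑' x, γ x = ∑' v, ξ ^ 3 * (dK2 ξ ν M₃ (w + unitVec ρ) v * κ v) := by
    rw [tsum_congr hγre]
    exact (Equiv.subRight (unitVec ν)).tsum_eq (fun v => ξ ^ 3 * (dK2 ξ ν M₃ (w + unitVec ρ) v * κ v))
  have hbγ : |∑' x, γ x| ≤ K * (16 * Real.exp 1 ^ 2 * C) := by rw [heγ]; exact hbγv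
  -- term θ: value law of `C` against the mixed-difference law of `M₃` (shifted by `e_ν`)
  obtain ⟨hsθP, hbθP⟩ := tsum_profile_one_mul_le hξ hξ1 hδ' hδ'1 w w
  have hptθ : ∀ x : ZSite 3, |θ x| ≤ 2 * Real.exp 1 * C * K *
      (ξ ^ 3 * (prof ξ (δ / 2) 1 (w - x) * prof ξ (δ / 2) 1 (x - w))) := by
    intro x
    simp only [hθ]
    rw [abs_mul, abs_of_pos (pow_pos hξ 3), abs_mul]
    have h1 : |Cf (w - x)| ≤ C * prof ξ (δ / 2) 1 (w - x) :=
      (hCx1 _).trans (mul_le_mul_of_nonneg_left (prof_mono_rate hξ.le (by linarith) 1 _) hC)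
    have h2 : |d2K ξ ρ ν M₃ w (x - unitVec ν)| ≤ 2 * Real.exp 1 * K * prof ξ (δ / 2) 1 (x - w) := by
      refine (hM3d2 ρ ν w (x - unitVec ν)).trans ?_
      rw [show w - (x - unitVec ν) = (w - x) + unitVec ν by abel, prof_sub_comm ξ (δ / 2) 1 x w]
      have hs := prof_shift_le hξ hξ1 hδ'.le hδ'1 1 (w - x) (unitVec ν) (supNorm_unitVec ν).1.le
      calc K * prof ξ (δ / 2) 1 (w - x + unitVec ν) ≤ K * (2 ^ 1 * Real.exp 1 * prof ξ (δ / 2) 1 (w - x)) :=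
            mul_le_mul_of_nonneg_left hs hK
        _ = 2 * Real.exp 1 * K * prof ξ (δ / 2) 1 (w - x) := by ring
    have hp1 := prof_nonneg hξ.le (δ / 2) 1 (w - x)
    calc ξ ^ 3 * (|Cf (w - x)| * |d2K ξ ρ ν M₃ w (x - unitVec ν)|)
        ≤ ξ ^ 3 * ((C * prof ξ (δ / 2) 1 (w - x)) * (2 * Real.exp 1 * K * prof ξ (δ / 2) 1 (x - w))) :=
          mul_le_mul_of_nonneg_left (mul_le_mul h1 h2 (abs_nonneg _) (by positivity)) (pow_pos hξ 3).le
      _ = 2 * Real.exp 1 * C * K * (ξ ^ 3 * (prof ξ (δ / 2) 1 (w - x) * prof ξ (δ / 2) 1 (x - w))) := by ring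
  have hsθ : Summable θ := (Summable.of_nonneg_of_le (fun x => abs_nonneg _) hptθ (hsθP.mul_left _)).of_abs
  have hbθ : |∑' x, θ x| ≤ 2 * Real.exp 1 * C * K * (833 / (δ / 2) ^ 3) := by
    refine (abs_tsum_le_tsum_of_abs_le hsθ (hsθP.mul_left _) hptθ).trans ?_
    rw [tsum_mul_left]
    exact mul_le_mul_of_nonneg_left hbθP (by positivity)
  -- assemble: `−A − (−B) = −(A − B)`, `A − B = Σ'(famA − famB) = ξ(Σγ + Σθ)`
  have hA := hsS (w + unitVec ρ)
  have hB := hsS w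
  rw [neg_sub_neg, abs_sub_comm, ← hA.tsum_sub hB, tsum_congr hpt, tsum_mul_left, hsγ.tsum_add hsθ, abs_mul,
    abs_of_pos hξ]
  exact mul_le_mul_of_nonneg_left ((abs_add_le _ _).trans (add_le_add hbγ hbθ)) hξ.le

/-- **THE LATTICE DERIVATIVE OF THE LOOP IS BOUNDED UNIFORMLY**: `|B_ν[G₂,G₃](w+e_ρ) − B_ν[G₂,G₃](w)| ≤ ξ·Λ₁`,
`Λ₁ = (2eCK·833/(δ/2)³ + KC) + (16e²CK + 2eCK·833/(δ/2)³)` — the pure-`C^ξ` loop drops out EXACTLY (it does not depend on the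
vertex: this is print's *"translation invariance"*), and the two terms with a difference kernel have bounded lattice derivatives
(`abs_loopMG_diff_le`, `abs_loopCM_diff_le`).  No translation invariance of the lattice propagators is used.
[cite: Balaban1983Higgs3, p.444] -/
theorem abs_loop221c_diff_le (hξ : 0 < ξ) (hξ1 : ξ ≤ 1) (hδ : 0 < δ) (hδ1 : δ ≤ 1) (hC : 0 ≤ C) (hK : 0 ≤ K) {K₂ : ℝ}
    {Cf : ZSite 3 → ℝ} {G₂ M₂ G₃ M₃ : ZSite 3 → ZSite 3 → ℝ} (hCs : Summable Cf)
    (hG2 : ∀ y x, G₂ y x = Cf (y - x) + M₂ y x) (hG3e : ∀ y x, G₃ y x = Cf (y - x) + M₃ y x)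
    (hCx1 : ∀ u, |Cf u| ≤ C * prof ξ δ 1 u)
    (hCx2a : ∀ (μ : Fin 3) (u : ZSite 3), |pdiffAdjZ ξ⁻¹ μ Cf u| ≤ C * prof ξ δ 2 u)
    (hCx2 : ∀ (μ : Fin 3) (u : ZSite 3), |pdiffZ ξ⁻¹ μ Cf u| ≤ C * prof ξ δ 2 u)
    (hG3 : ∀ y x, |G₃ y x| ≤ C * prof ξ δ 1 (y - x))
    (hG3d : ∀ (μ : Fin 3) (y x : ZSite 3), |dK1 ξ μ G₃ y x| ≤ C * prof ξ δ 2 (y - x))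
    (hM3 : ∀ y y', |M₃ y y'| ≤ K) (hM3d1 : ∀ (μ : Fin 3) (y x : ZSite 3), |dK2 ξ μ M₃ y x| ≤ ξ⁻¹ * K)
    (hM3d2 : ∀ (μ' μ : Fin 3) (x y : ZSite 3), |d2K ξ μ' μ M₃ x y| ≤ K * prof ξ (δ / 2) 1 (x - y))
    (hM2d2 : ∀ (μ' μ : Fin 3) (x y : ZSite 3), |d2K ξ μ' μ M₂ x y| ≤ K * prof ξ (δ / 2) 1 (x - y))
    (hF2 : ∀ (μ' : Fin 3) (y : ZSite 3) (κ : ZSite 3 → ℝ) (b : ℝ), 0 ≤ b →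
      (∀ x', |κ x'| ≤ b * prof ξ δ 2 (x' - y)) →
      Summable (fun x' => ξ ^ 3 * (dK2 ξ μ' M₂ y x' * κ x')) ∧ |∑' x', ξ ^ 3 * (dK2 ξ μ' M₂ y x' * κ x')| ≤ K * b)
    (hF2h : ∀ (μ' : Fin 3) (y : ZSite 3) (κ : ZSite 3 → ℝ) (b : ℝ), 0 ≤ b →
      (∀ x', |κ x'| ≤ b * prof ξ (δ / 2) 2 (x' - y)) →
      Summable (fun x' => ξ ^ 3 * (dK2 ξ μ' M₂ y x' * κ x')) ∧ |∑' x', ξ ^ 3 * (dK2 ξ μ' M₂ y x' * κ x')| ≤ K₂ * b)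
    (hF3 : ∀ (μ' : Fin 3) (y : ZSite 3) (κ : ZSite 3 → ℝ) (b : ℝ), 0 ≤ b →
      (∀ x', |κ x'| ≤ b * prof ξ δ 2 (x' - y)) →
      Summable (fun x' => ξ ^ 3 * (dK2 ξ μ' M₃ y x' * κ x')) ∧ |∑' x', ξ ^ 3 * (dK2 ξ μ' M₃ y x' * κ x')| ≤ K * b)
    (ν ρ : Fin 3) (w : ZSite 3) :
    |loop221c ξ ν G₂ G₃ (w + unitVec ρ) - loop221c ξ ν G₂ G₃ w| ≤
      ξ * ((2 * Real.exp 1 * C * K * (833 / (δ / 2) ^ 3) + K * C) +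
        (K * (16 * Real.exp 1 ^ 2 * C) + 2 * Real.exp 1 * C * K * (833 / (δ / 2) ^ 3))) := by
  rw [loop221c_eq_split hξ hξ1 hδ hδ1 hC hK hCs hG2 hG3e hCx1 hCx2a hG3 hM3 hF2h ν (w + unitVec ρ),
    loop221c_eq_split hξ hξ1 hδ hδ1 hC hK hCs hG2 hG3e hCx1 hCx2a hG3 hM3 hF2h ν w]
  have h1 := abs_loopMG_diff_le hξ hξ1 hδ hδ1 hC hK hG3 hG3d hM2d2 hF2 hF2h ν ρ w
  have h2 := abs_loopCM_diff_le hξ hξ1 hδ hδ1 hC hK hCx1 hCx2 hM3 hM3d1 hM3d2 hF3 ν ρ w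
  rw [show ∀ c a' b' a b : ℝ, c + a' + b' - (c + a + b) = (b' - b) + (a' - a) from fun _ _ _ _ _ => by ring, mul_add]
  exact (abs_add_le _ _).trans (add_le_add h1 h2)

/-- **THE TERM WITH `C^ξ` ON THE DIFFERENTIATED LINE is convergent**: after the summation by parts in the internal vertex,
`|F[C,G₂,G₃](x′)| ≤ Σ_νΣ_zξ³|(∂_μC)(x′−z)|·ξ^{−1}|B_ν(z−e_ν) − B_ν(z)| ≤ 3C·833/δ³·Λ₁` for loop lines with `|B_ν| ≤ Λ₀` and
`|B_ν(w+e_ρ) − B_ν(w)| ≤ ξΛ₁`; and the `z`-series of `F[C,G₂,G₃]` converges absolutely. [cite: Balaban1983Higgs3, p.444] -/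
theorem abs_fac221c_convK_le (hξ : 0 < ξ) (hξ1 : ξ ≤ 1) (hδ : 0 < δ) (hδ1 : δ ≤ 1) (hC : 0 ≤ C) {Λ₀ Λ₁ : ℝ}
    (hΛ₁ : 0 ≤ Λ₁) {Cf : ZSite 3 → ℝ} {G₂ G₃ : ZSite 3 → ZSite 3 → ℝ}
    (hCx2 : ∀ (μ : Fin 3) (u : ZSite 3), |pdiffZ ξ⁻¹ μ Cf u| ≤ C * prof ξ δ 2 u)
    (hloop : ∀ (ν : Fin 3) (z : ZSite 3), |loop221c ξ ν G₂ G₃ z| ≤ Λ₀)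
    (hdiff : ∀ (ν ρ : Fin 3) (w : ZSite 3), |loop221c ξ ν G₂ G₃ (w + unitVec ρ) - loop221c ξ ν G₂ G₃ w| ≤ ξ * Λ₁)
    (μ : Fin 3) (x' : ZSite 3) :
    Summable (fun z : ZSite 3 => ξ ^ 3 * ∑ ν : Fin 3, d2K ξ μ ν (convK Cf) x' z * loop221c ξ ν G₂ G₃ z) ∧
      |fac221c ξ μ (convK Cf) G₂ G₃ x'| ≤ 3 * C * (833 / δ ^ 3) * Λ₁ := by
  set g : ZSite 3 → ℝ := fun z => dK1 ξ μ (convK Cf) x' z with hg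
  have hgb : ∀ z : ZSite 3, |g z| ≤ C * prof ξ δ 2 (z - x') := by
    intro z; simp only [hg]; rw [dK1_conv, prof_sub_comm ξ δ 2 z x']; exact hCx2 μ _
  have hgbs : ∀ (ν : Fin 3) (z : ZSite 3), |g (z + unitVec ν)| ≤ 4 * Real.exp 1 * C * prof ξ δ 2 (z - x') := by
    intro ν z
    simp only [hg]
    rw [dK1_conv]
    refine (hCx2 μ _).trans ?_
    rw [show x' - (z + unitVec ν) = -((z - x') + unitVec ν) by abel,
      show prof ξ δ 2 (-((z - x') + unitVec ν)) = prof ξ δ 2 ((z - x') + unitVec ν) by unfold prof; rw [supNorm_neg]]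
    calc C * prof ξ δ 2 (z - x' + unitVec ν) ≤ C * (2 ^ 2 * Real.exp 1 * prof ξ δ 2 (z - x')) :=
          mul_le_mul_of_nonneg_left (prof_shift_le hξ hξ1 hδ.le hδ1 2 (z - x') (unitVec ν) (supNorm_unitVec ν).1.le) hC
      _ = 4 * Real.exp 1 * C * prof ξ δ 2 (z - x') := by ring
  have hP := summable_prof_sub' hξ hξ1 hδ hδ1 (le_refl 2) x'
  have h2 : ∀ ν : Fin 3, Summable fun z : ZSite 3 => g z * loop221c ξ ν G₂ G₃ z := by
    intro ν
    refine Summable.of_norm_bounded (g := fun z => C * Λ₀ * prof ξ δ 2 (z - x')) (hP.mul_left _) fun z => ?_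
    rw [Real.norm_eq_abs, abs_mul]
    have hp := prof_nonneg hξ.le δ 2 (z - x')
    calc |g z| * |loop221c ξ ν G₂ G₃ z| ≤ (C * prof ξ δ 2 (z - x')) * Λ₀ :=
          mul_le_mul (hgb z) (hloop ν z) (abs_nonneg _) (by positivity)
      _ = C * Λ₀ * prof ξ δ 2 (z - x') := by ring
  have h1 : ∀ ν : Fin 3, Summable fun z : ZSite 3 => g (z + unitVec ν) * loop221c ξ ν G₂ G₃ z := by
    intro ν
    refine Summable.of_norm_bounded (g := fun z => 4 * Real.exp 1 * C * Λ₀ * prof ξ δ 2 (z - x')) (hP.mul_left _)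
      fun z => ?_
    rw [Real.norm_eq_abs, abs_mul]
    have hp := prof_nonneg hξ.le δ 2 (z - x')
    calc |g (z + unitVec ν)| * |loop221c ξ ν G₂ G₃ z| ≤ (4 * Real.exp 1 * C * prof ξ δ 2 (z - x')) * Λ₀ :=
          mul_le_mul (hgbs ν z) (hloop ν z) (abs_nonneg _) (by positivity)
      _ = 4 * Real.exp 1 * C * Λ₀ * prof ξ δ 2 (z - x') := by ring
  -- summability of the `z`-family of `F[C,G₂,G₃]`
  have hsum : Summable (fun z : ZSite 3 => ξ ^ 3 * ∑ ν : Fin 3, d2K ξ μ ν (convK Cf) x' z * loop221c ξ ν G₂ G₃ z) := by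
    have hpt : ∀ z : ZSite 3, ξ ^ 3 * ∑ ν : Fin 3, d2K ξ μ ν (convK Cf) x' z * loop221c ξ ν G₂ G₃ z =
        ∑ ν : Fin 3, ξ ^ 2 * ((g (z + unitVec ν) - g z) * loop221c ξ ν G₂ G₃ z) := by
      intro z
      rw [mul_sum]
      refine sum_congr rfl fun ν _ => ?_
      rw [d2K_convK_eq_fwdDiff]
      simp only [hg]
      have hξ0 : ξ ≠ 0 := hξ.ne'
      field_simp
    refine (summable_sum (s := (univ : Finset (Fin 3))) fun ν _ => ?_).congr fun z => (hpt z).symm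
    refine (((h1 ν).sub (h2 ν)).mul_left (ξ ^ 2)).congr fun z => ?_
    ring
  refine ⟨hsum, ?_⟩
  rw [fac221c_convK_eq_sbp hξ.ne' μ Cf G₂ G₃ x' h1 h2]
  -- each `ν`-term is bounded by `CΛ₁·833/δ³`
  obtain ⟨hsP3, hbP3⟩ := summable_prof_sub hξ hξ1 hδ hδ1 (le_refl 2) x'
  have hν : ∀ ν : Fin 3, |ξ ^ 2 * ∑' z : ZSite 3, g z *
      (loop221c ξ ν G₂ G₃ (z - unitVec ν) - loop221c ξ ν G₂ G₃ z)| ≤ C * Λ₁ * (833 / δ ^ 3) := by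
    intro ν
    have hsd : Summable fun z : ZSite 3 => g z * (loop221c ξ ν G₂ G₃ (z - unitVec ν) - loop221c ξ ν G₂ G₃ z) := by
      refine ((summable_shift_mul (unitVec ν) (h1 ν)).sub (h2 ν)).congr fun z => ?_
      ring
    rw [← tsum_mul_left]
    have hpt : ∀ z : ZSite 3, |ξ ^ 2 * (g z * (loop221c ξ ν G₂ G₃ (z - unitVec ν) - loop221c ξ ν G₂ G₃ z))| ≤
        C * Λ₁ * (ξ ^ 3 * prof ξ δ 2 (z - x')) := by
      intro z
      have hd : |loop221c ξ ν G₂ G₃ (z - unitVec ν) - loop221c ξ ν G₂ G₃ z| ≤ ξ * Λ₁ := by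
        have h := hdiff ν ν (z - unitVec ν)
        rw [sub_add_cancel] at h
        rwa [abs_sub_comm] at h
      rw [abs_mul, abs_of_pos (pow_pos hξ 2), abs_mul]
      have hp := prof_nonneg hξ.le δ 2 (z - x')
      calc ξ ^ 2 * (|g z| * |loop221c ξ ν G₂ G₃ (z - unitVec ν) - loop221c ξ ν G₂ G₃ z|)
          ≤ ξ ^ 2 * ((C * prof ξ δ 2 (z - x')) * (ξ * Λ₁)) :=
            mul_le_mul_of_nonneg_left (mul_le_mul (hgb z) hd (abs_nonneg _) (by positivity)) (pow_pos hξ 2).le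
        _ = C * Λ₁ * (ξ ^ 3 * prof ξ δ 2 (z - x')) := by ring
    refine (abs_tsum_le_tsum_of_abs_le (hsd.mul_left _) (hsP3.mul_left _) hpt).trans ?_
    rw [tsum_mul_left]
    exact mul_le_mul_of_nonneg_left hbP3 (by positivity)
  refine (abs_sum_le_sum_abs _ _).trans ?_
  calc ∑ ν : Fin 3, |ξ ^ 2 * ∑' z : ZSite 3, g z * (loop221c ξ ν G₂ G₃ (z - unitVec ν) - loop221c ξ ν G₂ G₃ z)|
      ≤ ∑ _ν : Fin 3, C * Λ₁ * (833 / δ ^ 3) := sum_le_sum fun ν _ => hν ν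
    _ = 3 * C * (833 / δ ^ 3) * Λ₁ := by simp [sum_const, card_univ, Fintype.card_fin]; ring

/-- **the split of the differentiated line**: `F[G₁,G₂,G₃] = F[M₁,G₂,G₃] + F[C,G₂,G₃]` for `G₁ = C + M₁` (the mixed difference
is linear in the kernel), when both `z`-series converge. [cite: Balaban1983Higgs3, p.444] -/
theorem fac221c_split_first (ξ : ℝ) (μ : Fin 3) {Cf : ZSite 3 → ℝ} {G₁ M₁ G₂ G₃ : ZSite 3 → ZSite 3 → ℝ}
    (hG1 : ∀ y x, G₁ y x = Cf (y - x) + M₁ y x) (x' : ZSite 3)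
    (hsM : Summable (fun z : ZSite 3 => ξ ^ 3 * ∑ ν : Fin 3, d2K ξ μ ν M₁ x' z * loop221c ξ ν G₂ G₃ z))
    (hsC : Summable (fun z : ZSite 3 => ξ ^ 3 * ∑ ν : Fin 3, d2K ξ μ ν (convK Cf) x' z * loop221c ξ ν G₂ G₃ z)) :
    fac221c ξ μ G₁ G₂ G₃ x' = fac221c ξ μ M₁ G₂ G₃ x' + fac221c ξ μ (convK Cf) G₂ G₃ x' := by
  have hd : ∀ (ν : Fin 3) (z : ZSite 3), d2K ξ μ ν G₁ x' z = d2K ξ μ ν M₁ x' z + d2K ξ μ ν (convK Cf) x' z := by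
    intro ν z
    simp only [d2K, convK, hG1]
    rw [show x' + unitVec μ - (z + unitVec ν) = x' + unitVec μ - (z + unitVec ν) by rfl]
    ring
  have hpt : ∀ z : ZSite 3, ξ ^ 3 * ∑ ν : Fin 3, d2K ξ μ ν G₁ x' z * loop221c ξ ν G₂ G₃ z =
      ξ ^ 3 * ∑ ν : Fin 3, d2K ξ μ ν M₁ x' z * loop221c ξ ν G₂ G₃ z +
        ξ ^ 3 * ∑ ν : Fin 3, d2K ξ μ ν (convK Cf) x' z * loop221c ξ ν G₂ G₃ z := by
    intro z
    simp_rw [hd, add_mul, sum_add_distrib, mul_add]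
  unfold fac221c
  rw [tsum_congr hpt, hsM.tsum_add hsC]

end Loop

/-! ## §4 The replacement sentence for the graph (2.21c) at the zero-field instance on ξℤ³ -/

section Main

variable {ℓ : ℕ}

/-- **p. 444 FOR THE GRAPH (2.21c), ON THE PRINTED INFINITE LATTICE ξℤ³** — *"Now we replace the propagators G^η_{j₀}(0), G^η_{j₀}
by C^ξ in the way described several times. We get a convergent expression plus Σ_{y,y″}ξ^{2d}Γ″_μ(y,y′,y″) defined with the help of
the propagator C^ξ. … For the graph (2.21c) it equals 0 also because by translation invariance it can be written as a derivative
of a constant"*: for `L = ℓ + 1 ≥ 2` and a window `[a₋,a₊] × [0,m²₊]` (`a₋ > 0`) there is `Cst > 0` such that for every `k ≥ 1`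
(`ξ = L^{−k}`), all `(a₁,m₁²), (a₂,m₂²), (a₃,m₃²)` in the window (the parameters of the differentiated line `G₁ = G^ξ_k(0)` from
`x′` to the internal vertex, of the scalar loop line `G₂` and of the vector loop line `G₃`), all `μ`, `x′`:
(i) the loop series `B_ν[G₂,G₃](z)` and the `z`-series defining the factor `F[G₁,G₂,G₃](x′)` converge absolutely;
(ii) `|F[G₁,G₂,G₃](x′) − F[C^ξ,C^ξ,C^ξ](x′)| ≤ Cst` — the terms containing the difference kernel `M = G − C^ξ` are bounded
UNIFORMLY in the spacing and the position (*"a convergent expression"*), although the factor is of degree `0`;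
(iii) `F[C^ξ,C^ξ,C^ξ](x′) = 0` — *"a derivative of a constant"*;
(iv) hence `|F[G₁,G₂,G₃](x′)| ≤ Cst`: the coefficient of the local vertex (3.36) for the graph (2.21c) is bounded uniformly.
No translation invariance of `G_k(0)` is used. [cite: Balaban1983Higgs3, p.444] -/
theorem exists_fac221c_bound (hℓ : 1 ≤ ℓ) (amin aplus m2plus : ℝ) (ha : 0 < amin) :
    ∃ Cst : ℝ, 0 < Cst ∧ ∀ (k : ℕ), 1 ≤ k → ∀ (a₁ m₁ a₂ m₂ a₃ m₃ : ℝ), amin ≤ a₁ → a₁ ≤ aplus → 0 ≤ m₁ → m₁ ≤ m2plus →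
      amin ≤ a₂ → a₂ ≤ aplus → 0 ≤ m₂ → m₂ ≤ m2plus → amin ≤ a₃ → a₃ ≤ aplus → 0 ≤ m₃ → m₃ ≤ m2plus →
      ∀ (μ : Fin 3) (x' : ZSite 3),
      (∀ (ν : Fin 3) (z : ZSite 3), Summable (fun x : ZSite 3 => (xiOf ℓ k) ^ 3 *
          (dK2 (xiOf ℓ k) ν (GxiL ℓ k a₂ m₂) z x * GxiL ℓ k a₃ m₃ z x))) ∧
      Summable (fun z : ZSite 3 => (xiOf ℓ k) ^ 3 * ∑ ν : Fin 3,
          d2K (xiOf ℓ k) μ ν (GxiL ℓ k a₁ m₁) x' z * loop221c (xiOf ℓ k) ν (GxiL ℓ k a₂ m₂) (GxiL ℓ k a₃ m₃) z) ∧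
      |fac221c (xiOf ℓ k) μ (GxiL ℓ k a₁ m₁) (GxiL ℓ k a₂ m₂) (GxiL ℓ k a₃ m₃) x' -
          fac221c (xiOf ℓ k) μ (convK (Cxi 3 (xiOf ℓ k))) (convK (Cxi 3 (xiOf ℓ k))) (convK (Cxi 3 (xiOf ℓ k))) x'|
        ≤ Cst ∧
      fac221c (xiOf ℓ k) μ (convK (Cxi 3 (xiOf ℓ k))) (convK (Cxi 3 (xiOf ℓ k))) (convK (Cxi 3 (xiOf ℓ k))) x' = 0 ∧
      |fac221c (xiOf ℓ k) μ (GxiL ℓ k a₁ m₁) (GxiL ℓ k a₂ m₂) (GxiL ℓ k a₃ m₃) x'| ≤ Cst := by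
  obtain ⟨δ, C, K, hδ, hδh, hC1, hK, H⟩ := exists_bounds hℓ amin aplus m2plus ha
  have hδ1 : δ ≤ 1 := hδh.trans (by norm_num)
  have hC0 : 0 ≤ C := le_trans (by norm_num) hC1
  have hK0 : 0 ≤ K := hK.le
  have hδ' : 0 < δ / 2 := by linarith
  -- the constants: Fubini at rate δ/2 (`K₂`), the loop (`Λ₀`), its lattice derivative (`Λ₁`), the two terms of the factor
  set K₂ : ℝ := C * C * (1400 * (833 / (δ / 2 / 2) ^ 3)) with hK₂
  set Λ₀ : ℝ := 1 / 2 * C ^ 2 * 53 + C * K * (833 / δ ^ 3) + K₂ * (C * (1 + 2 / δ)) with hΛ₀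
  set Λ₁ : ℝ := (2 * Real.exp 1 * C * K * (833 / (δ / 2) ^ 3) + K * C) +
    (K * (16 * Real.exp 1 ^ 2 * C) + 2 * Real.exp 1 * C * K * (833 / (δ / 2) ^ 3)) with hΛ₁
  have hK₂0 : 0 ≤ K₂ := by positivity
  have hΛ₀0 : 0 ≤ Λ₀ := by positivity
  have hΛ₁0 : 0 ≤ Λ₁ := by positivity
  refine ⟨3 * K * Λ₀ * (833 / (δ / 2) ^ 3) + 3 * C * (833 / δ ^ 3) * Λ₁ + 1, by positivity, ?_⟩
  intro k hk a₁ m₁ a₂ m₂ a₃ m₃ ha1 ha1' hm1 hm1' ha2 ha2' hm2 hm2' ha3 ha3' hm3 hm3' μ x'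
  -- the laws of the three lines (gen 9's bundle, one rate `δ`)
  obtain ⟨⟨-, -, -, -, -, -, l7, l8, l9⟩, -, hM1d2, -, -, -, -⟩ := H k hk a₁ m₁ ha1 ha1' hm1 hm1'
  obtain ⟨⟨-, -, -, -, -, -, -, -, -⟩, -, hM2d2, -, hF2, hF2', -⟩ := H k hk a₂ m₂ ha2 ha2' hm2 hm2'
  obtain ⟨⟨g3, g3d, -, -, -, -, -, -, -⟩, hM3, hM3d2, hM3d1, hF3, -, -⟩ := H k hk a₃ m₃ ha3 ha3' hm3 hm3'
  set ξ := xiOf ℓ k with hξdef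
  have hξ : 0 < ξ := xiOf_pos ℓ k
  have hξ1 : ξ ≤ 1 := xiOf_le_one ℓ k
  set G₁ := GxiL ℓ k a₁ m₁ with hG₁
  set G₂ := GxiL ℓ k a₂ m₂ with hG₂
  set G₃ := GxiL ℓ k a₃ m₃ with hG₃
  set M₁ := MxiL ℓ k a₁ m₁ with hM₁
  set M₂ := MxiL ℓ k a₂ m₂ with hM₂
  set M₃ := MxiL ℓ k a₃ m₃ with hM₃d
  set Cx := Cxi 3 ξ with hCx
  -- `G_i = C^ξ + M_i`
  have hGe : ∀ (a m : ℝ) (y x : ZSite 3), GxiL ℓ k a m y x = Cx (y - x) + MxiL ℓ k a m y x := fun a m y x => by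
    rw [GxiL_eq_conv_add]; rfl
  have hG1e : ∀ y x, G₁ y x = Cx (y - x) + M₁ y x := hGe a₁ m₁
  have hG2e : ∀ y x, G₂ y x = Cx (y - x) + M₂ y x := hGe a₂ m₂
  have hG3e : ∀ y x, G₃ y x = Cx (y - x) + M₃ y x := hGe a₃ m₃
  have hCs : Summable Cx := summable_Cxi hξ
  -- the Fubini clause for `M₂∂^*` at rate `δ/2` in the `K₂ * b` shape
  have hF2h : ∀ (μ' : Fin 3) (y : ZSite 3) (κ : ZSite 3 → ℝ) (b : ℝ), 0 ≤ b →
      (∀ x', |κ x'| ≤ b * prof ξ (δ / 2) 2 (x' - y)) →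
      Summable (fun x' => ξ ^ 3 * (dK2 ξ μ' M₂ y x' * κ x')) ∧
        |∑' x', ξ ^ 3 * (dK2 ξ μ' M₂ y x' * κ x')| ≤ K₂ * b := by
    intro μ' y κ b hb hκ
    obtain ⟨hs, hle⟩ := hF2' (δ / 2) hδ' (by linarith) μ' y κ b hb hκ
    exact ⟨hs, hle.trans_eq (by rw [hK₂]; ring)⟩
  -- (a) the loop: absolutely convergent, bounded by `Λ₀`, lattice derivative bounded by `ξΛ₁`
  have hloop : ∀ (ν : Fin 3) (z : ZSite 3),
      Summable (fun x : ZSite 3 => ξ ^ 3 * (dK2 ξ ν G₂ z x * G₃ z x)) ∧ |loop221c ξ ν G₂ G₃ z| ≤ Λ₀ :=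
    fun ν z => abs_loop221c_le hξ hξ1 hδ hδ1 hC0 hK0 hCs hG2e hG3e l7 l8 g3 hM3 hF2h ν z
  have hdiff : ∀ (ν ρ : Fin 3) (w : ZSite 3),
      |loop221c ξ ν G₂ G₃ (w + unitVec ρ) - loop221c ξ ν G₂ G₃ w| ≤ ξ * Λ₁ :=
    fun ν ρ w => abs_loop221c_diff_le hξ hξ1 hδ hδ1 hC0 hK0 hCs hG2e hG3e l7 l8 l9 g3 g3d hM3 hM3d1 hM3d2 hM2d2
      hF2 hF2h hF3 ν ρ w
  -- (b) the two terms of the factor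
  obtain ⟨hsM, hbM⟩ := abs_fac221c_M_le hξ hξ1 hδ hδ1 hK0 hΛ₀0 hM1d2 (fun ν z => (hloop ν z).2) μ x'
  obtain ⟨hsC, hbC⟩ := abs_fac221c_convK_le hξ hξ1 hδ hδ1 hC0 hΛ₁0 l9 (fun ν z => (hloop ν z).2) hdiff μ x'
  have hsplit : fac221c ξ μ G₁ G₂ G₃ x' = fac221c ξ μ M₁ G₂ G₃ x' + fac221c ξ μ (convK Cx) G₂ G₃ x' :=
    fac221c_split_first ξ μ hG1e x' hsM hsC
  have hzero : fac221c ξ μ (convK Cx) (convK Cx) (convK Cx) x' = 0 := fac221c_Cxi_eq_zero hξ μ x'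
  -- (i) summability of the full `z`-family via the split of the differentiated line
  have hd : ∀ (ν : Fin 3) (z : ZSite 3), d2K ξ μ ν G₁ x' z = d2K ξ μ ν M₁ x' z + d2K ξ μ ν (convK Cx) x' z := by
    intro ν z
    simp only [d2K, convK, hG1e]
    ring
  have hsG : Summable (fun z : ZSite 3 => ξ ^ 3 * ∑ ν : Fin 3, d2K ξ μ ν G₁ x' z * loop221c ξ ν G₂ G₃ z) := by
    refine (hsM.add hsC).congr fun z => ?_
    simp_rw [hd, add_mul, sum_add_distrib, mul_add]
  have hii : |fac221c ξ μ G₁ G₂ G₃ x' - fac221c ξ μ (convK Cx) (convK Cx) (convK Cx) x'| ≤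
      3 * K * Λ₀ * (833 / (δ / 2) ^ 3) + 3 * C * (833 / δ ^ 3) * Λ₁ + 1 := by
    rw [hzero, sub_zero, hsplit]
    refine (abs_add_le _ _).trans ?_
    linarith [hbM, hbC]
  refine ⟨fun ν z => (hloop ν z).1, hsG, hii, hzero, ?_⟩
  have h4 := hii
  rwa [hzero, sub_zero] at h4

end Main







end

end Literature.MathematicalPhysics.QuantumFieldTheory.Balaban1983to89.B3Graph221cZeroLattice
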